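import Literature.AlgebraicGeometry.Surfaces.K3LatticeInvariantsOrientationProofs
import Literature.AlgebraicGeometry.Motives.KaehlerVolumePositivityProofs
import Literature.AlgebraicGeometry.Motives.HodgeDecompositionHardLefschetzDischarge
import Literature.AlgebraicGeometry.Motives.HodgeDecompositionHarmonicRepresentativeProofs
import Literature.AlgebraicGeometry.Motives.HodgeRiemannBilinearDischarge
import Literature.AlgebraicGeometry.HodgeTheory.HodgeTypeConjugation
import Literature.NumberTheory.Transcendental.KaehlerLefschetzHarmonicProofs
import Literature.NumberTheory.Transcendental.KaehlerIdentityLambdaProofs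
import Literature.NumberTheory.Transcendental.FormIntegrationAddProofs
import Literature.Topology.FourManifolds.IntersectionFormRealPositive
import Literature.Topology.FourManifolds.IntersectionLatticeProofs
import Literature.AlgebraicTopology.SingularHomology.FundamentalClassProofs
import Mathlib.LinearAlgebra.FreeModule.PID
import HarnessLib

/-!
# The signature `(3, 19)` of a K3 surface from the Hodge index theorem

[MAPPING §1: T-AG-SURF (Algebraic surfaces, K3) · T-MOTIVE (Hodge theory)]

This file completes the proof of the named fact
`Literature.AlgebraicGeometry.Surfaces.K3_exists_orientation_signature_hodgeRiemann_ample`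
(`K3LatticeInvariants.lean`: for every K3 surface `S` ONE `ℤ`-orientation `μ` of `S(ℂ)` has
(i) `τ(S(ℂ), μ) = b⁺ − b⁻ = −16`, (ii) the Hodge–Riemann positivity `(σ.σ̄) > 0` on `H^{2,0}`, and
(iii) an integral ample `(1,1)`-class of positive square) MODULO the single numerical input
`b₂(S) = 22`, i.e. modulo the sibling named fact `K3_finrank_complexBetti_two` (Noether's formula):

* `K3_exists_orientation_signature_hodgeRiemann_ample_of_finrank_complexBetti_two :
    K3_finrank_complexBetti_two → K3_exists_orientation_signature_hodgeRiemann_ample`.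

Clauses (ii) and (iii) were proved for the complex orientation in
`K3LatticeInvariantsOrientationProofs.lean` (`IsK3Surface.exists_orientation_hodgeRiemann_ample`),
which also reduced the fact to clause (i) for every (ii)-orientation
(`K3_exists_orientation_signature_hodgeRiemann_ample_of_signature`). Here clause (i) is proved.

v2 (appended): the engine is also stated WITHOUT the input `b₂ = 22`, as the Hodge index theorem
with sign `τ(S(ℂ), μ) = 6 − b₂(S)` for the complex orientation
(`IsK3Surface.exists_orientation_hodgeRiemann_signature_eq`; `(b⁺, b⁻) = (3, b₂ − 3)`), from which
the `b₂ = 22` form is a one-line corollary; this is the form consumed by the Hirzebruch–Wu route to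
`b₂ = 22` itself (`c₁² = 2e + 3τ`, `c₁ = 0`).

## The printed proof and how it is followed

Huybrechts, *Lectures on K3 Surfaces*, Ch. 1, proof of Prop. 3.5 (p. 24): "the intersection form
is even … of index `−16` (Thom–Hirzebruch index theorem `τ = (c₁² − 2c₂)/3`) … hence of signature
`(3, 19)`". The tree has no Pontryagin classes / cobordism, so instead of the Thom–Hirzebruch
signature theorem (Milnor–Stasheff §19 Thm. 19.4) we follow the OTHER printed road to the index of
a surface, the **Hodge index theorem with sign** (Voisin, *Hodge Theory I*, §6.3.2, Thm. 6.32 and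
Thm. 6.33: on a compact Kähler surface the intersection form is positive definite on
`(H^{2,0} ⊕ H^{0,2})_ℝ ⊕ ℝ[ω]` and negative definite on the primitive real `(1,1)`-classes, so that
`τ = 2 + 2h^{2,0} − h^{1,1}`; Huybrechts (2005), *Complex Geometry*, Prop. 3.3.15 and Cor. 3.3.18;
for K3: `τ = 2 + 2 − 20 = −16`, Huybrechts K3 Ch. 1 §2.3/§3.3, using `h^{1,1} = b₂ − 2 = 20`).
Every analytic ingredient is a PROVED theorem of the tree, and the argument is assembled here:

1. *Lattice ↔ real form* (`sigPos_intersectionForm_add_finrank_le`,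
   `sigNeg_intersectionForm_add_finrank_le`; Milnor–Husemoller §II.1): if the real cup pairing
   `y ↦ ⟨y ∪ y, [X] ⊗ 1⟩` is negative (resp. positive) definite on a real subspace `W ⊆ Hᵏ(X; ℝ)`,
   then `b⁺(Q_X) + dim W ≤ bₖ` (resp. `b⁻(Q_X) + dim W ≤ bₖ`): a maximal positive definite
   sublattice (Smith normal form basis, `Submodule.smithNormalForm`) maps to a real subspace of the
   same dimension (`linearIndependent_ringChange_of_basis`) on which the pairing is `≥ 0`
   (`sum_mul_mul_nonpos_of_int`), which meets `W` trivially.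
2. *The Kronecker functional of the complex orientation is a positive multiple of `∫_M`*
   (`exists_kroneckerPairing_eq_mul_integral`; de Rham's theorem read through a natural
   multiplicative family `e` and Stokes, `MForm.integral_eq_zero_of_mem_exactSmoothForms_holds`).
3. *Hodge index negativity* (`kroneckerPairing_cupProduct_self_neg_of_isOfHodgeType_oneOne`,
   Voisin Thm. 6.32 at `(p,q) = (1,1)`, `k = 2`, `r = 0`): a non-zero real class `y` with `y ⊗ 1`
   of type `(1,1)` and `y ∪ [ω] = 0` has `⟨y ∪ y, [X] ⊗ 1⟩ < 0`. Printed proof (Huybrechts (2005)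
   p. 163 / Voisin p. 150): the harmonic representative `β` of `y` (Hodge's theorem at a Kähler
   metric, `existsUnique_isHarmonicForm_mk_eq_of_compact_of_isKaehler`) has `ω ∧ β` harmonic
   (`[L, Δ] = 0`, `isHarmonicForm_kaehlerForm_wedge`) and null-cohomologous, hence zero, so `β` is
   primitive at every point; `β ⊗ 1` is `Δ_∂̄`-harmonic of type `(1,1)` (`Δ_d = 2Δ_∂̄`,
   `cHodgeLaplacian_eq_two_smul_dolbeaultLaplacian_of_isManifold_complex_of_t2Space`, and
   `isOfType_of_isCHarmonicForm_of_mk_eq`), and the Hodge–Riemann bilinear relation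
   (`hodge_riemann_bilinear_holds`, Huybrechts (2005) Prop. 3.3.15) gives `∫ β ∧ β < 0`.
4. *K3 assembly* (`IsK3Surface.exists_orientation_hodgeRiemann_signature`): for the complex
   orientation `μ` (the one of `exists_orientation_kroneckerPairing_pos_of_family`, which is also
   the (ii)-orientation and is Kähler-positive) the real classes `Re σ, Im σ, κ = [ω]` are pairwise
   orthogonal with positive squares (`(σ.σ̄) > 0`, `σ² = 0` — `IsK3Surface.cupProduct_twoZero_self` —,
   `κ ⊥ σ` by type — `Huybrechts_K3_hodgeTypes_H2_holds` (3) —, `κ² > 0`), so they span a positive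
   definite `3`-space `V`; its `B`-orthogonal `W` (dimension `≥ b₂ − 3`) consists of real classes
   orthogonal to `σ`, `σ̄` and `κ`, i.e. (Huybrechts Ch. 3 Prop. 3.5 / `Huybrechts_K3_hodgeTypes_H2`
   (3)) of primitive real `(1,1)`-classes, on which step 3 gives negativity. With step 1 twice and
   `b₂ = b⁺ + b⁻` (`finrank_eq_sigPos_add_sigNeg_intersectionForm_holds`, Milnor–Husemoller §V.1)
   and `b₂ = 22`: `(b⁺, b⁻) = (3, 19)`, `τ = −16`.
5. The (ii)-orientation is unique (`IsK3Surface.orientation_unique_of_hodgeRiemann_twoZero`), so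
   clause (i) holds for EVERY (ii)-orientation (`K3_signature_eq_of_hodgeRiemann_twoZero`), which is
   the hypothesis of `K3_exists_orientation_signature_hodgeRiemann_ample_of_signature`.

No named fact is introduced (D-0026); the only remaining input of
`K3_exists_orientation_signature_hodgeRiemann_ample` is `K3_finrank_complexBetti_two`.

## References

* D. Huybrechts, *Lectures on K3 Surfaces* (2016), Ch. 1 §2.3, §3.3 and Prop. 3.5 (proof, p. 24);
  Ch. 3 Prop. 3.5; Ch. 6 Prop. 1.2. [Huybrechts2016K3]
* C. Voisin, *Hodge Theory and Complex Algebraic Geometry I* (2002), §6.3.2 Thm. 6.32, Thm. 6.33;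
  §6.2.3 Lemma 6.28; Thm. 5.23. [VoisinHodgeI2002]
* D. Huybrechts, *Complex Geometry. An Introduction* (2005), Prop. 3.3.15, Cor. 3.3.18. [Huybrechts2005]
* J. Milnor, D. Husemoller, *Symmetric Bilinear Forms* (1973), §II.1, §V.1. [MilnorHusemoller1973]
* J. Milnor, J. Stasheff, *Characteristic Classes* (1974), §19 Thm. 19.4 (the road not taken).
  [MilnorStasheff1974]
-/

noncomputable section

open scoped Manifold ContDiff Topology
open CategoryTheory Module Bundle
open Literature.AlgebraicTopology.SingularHomology
open Literature.Topology.FourManifolds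
open Literature.Geometry.Kaehler (MForm IsSmoothForm IsClosedForm closedSmoothForms deRhamCohomology
  riemannianVolumeForm IsHarmonicForm)
open Literature.NumberTheory.Transcendental
open Literature.AlgebraicGeometry.Motives (kaehlerFormPow kaehlerFormPow_zero kaehlerFormPow_one
  kaehlerFormPow_succ isSmoothForm_kaehlerFormPow isClosedForm_kaehlerFormPow hodge_riemann_bilinear
  exists_orientation_integral_kaehlerFormPow_pos
  hodge_riemann_bilinear_holds
  cintegral re_cintegral existsUnique_isHarmonicForm_mk_eq_of_compact_of_isKaehler
  isOfType_of_isCHarmonicForm_of_mk_eq exists_isOfType_mk_eq_of_mem_hodgePQ)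

namespace Literature.AlgebraicGeometry.Surfaces

/-! ### Part A: lattice signature versus real definite subspaces -/

section LatticeAlgebra

/-- Expansion of a bilinear form on two finite combinations. [folklore] -/
theorem bilin_sum_smul_sum_smul {R L : Type*} [CommRing R] [AddCommGroup L] [Module R L]
    {ι : Type*} [Fintype ι] (Q : LinearMap.BilinForm R L) (v : ι → L) (m m' : ι → R) :
    Q (∑ i, m i • v i) (∑ j, m' j • v j) = ∑ i, ∑ j, m i * m' j * Q (v i) (v j) := by
  simp only [map_sum, map_smul, LinearMap.sum_apply, LinearMap.smul_apply, smul_eq_mul,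
    Finset.mul_sum]
  rw [Finset.sum_comm]
  refine Finset.sum_congr rfl fun i _ ↦ Finset.sum_congr rfl fun j _ ↦ ?_
  ring

/-- **A Smith frame of a maximal positive definite sublattice.** For a bilinear form `Q` on a
finite free module `M` over a linearly ordered principal ideal domain `R`, there are a basis `bM`
of `M`, an injection `f : Fin r ↪ _` with `r = b⁺(Q)` and non-zero scalars `d j` such that the
Gram form `(m) ↦ Σᵢⱼ mᵢ mⱼ dᵢ dⱼ Q(bM (f i), bM (f j))` is `≥ 0` on `Rʳ`: the vectors
`d j • bM (f j)` are a Smith normal form basis of a positive definite submodule of rank `b⁺(Q)`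
(`exists_finrank_eq_sigPos_and_posDef`, `Submodule.smithNormalForm`). [folklore] -/
theorem exists_smithFrame_sigPos {R M : Type*} [CommRing R] [LinearOrder R]
    [IsStrictOrderedRing R] [IsPrincipalIdealRing R] [AddCommGroup M] [Module R M] [Module.Finite R M]
    [Module.Free R M] (Q : LinearMap.BilinForm R M) :
    ∃ (r : ℕ) (bM : Basis (Fin (finrank R M)) R M) (f : Fin r ↪ Fin (finrank R M)) (d : Fin r → R),
      sigPos Q.toQuadraticMap = r ∧ (∀ j, d j ≠ 0) ∧
      ∀ m : Fin r → R, 0 ≤ ∑ i, ∑ j, m i * m j * (d i * d j * Q (bM (f i)) (bM (f j))) := by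
  classical
  obtain ⟨P, hP, hpos⟩ := exists_finrank_eq_sigPos_and_posDef Q.toQuadraticMap
  obtain ⟨r, bM, bN, f, d, hsnf⟩ := P.smithNormalForm (Module.finBasis R M)
  have hd : ∀ j, d j ≠ 0 := by
    intro j hj
    have h0 : (bN j : M) = 0 := by rw [hsnf j, hj, zero_smul]
    exact bN.ne_zero j (Subtype.ext h0)
  have hPr : finrank R P = r := by
    rw [Module.finrank_eq_card_basis bN, Fintype.card_fin]
  refine ⟨r, bM, f, d, hP.symm.trans hPr, hd, fun m ↦ ?_⟩
  -- `Σᵢⱼ mᵢ mⱼ dᵢ dⱼ Q(bM fi, bM fj) = Q(z, z)` for `z = Σ mⱼ bN j ∈ P`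
  set z : P := ∑ j, m j • bN j with hz
  have hzM : (z : M) = ∑ j, (m j * d j) • bM (f j) := by
    rw [hz, Submodule.coe_sum]
    refine Finset.sum_congr rfl fun j _ ↦ ?_
    rw [Submodule.coe_smul, hsnf j, smul_smul]
  have hQz : Q (z : M) (z : M) = ∑ i, ∑ j, m i * m j * (d i * d j * Q (bM (f i)) (bM (f j))) := by
    rw [hzM, bilin_sum_smul_sum_smul]
    refine Finset.sum_congr rfl fun i _ ↦ Finset.sum_congr rfl fun j _ ↦ ?_
    ring
  rw [← hQz]
  by_cases h0 : z = 0
  · rw [h0, Submodule.coe_zero, map_zero]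
  · have h1 := hpos z h0
    rw [QuadraticMap.restrict_apply, LinearMap.BilinMap.toQuadraticMap_apply] at h1
    exact h1.le

end LatticeAlgebra

section Lattice

variable {X : Type} [TopologicalSpace X] [T2Space X] [CompactSpace X] {k n : ℕ}
  [ChartedSpace (EuclideanSpace ℝ (Fin n)) X]

/-- **Thom's inequality across the change of coefficients `ℤ → ℝ` (negative side).** For a
closed `ℤ`-oriented `n`-manifold `X`, `n = k + k`, and a real subspace `W ⊆ Hᵏ(X; ℝ)` on which the
real cup pairing `y ↦ ⟨y ∪ y, [X] ⊗ 1⟩` is negative definite, `b⁺(Q_X) + dim W ≤ dim Hᵏ(X; ℝ)`: a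
maximal positive definite sublattice (Smith normal form basis) spans a real subspace of the same
dimension on which the pairing is `≥ 0` (Milnor–Husemoller §II.1: the index of a lattice is that of
its real form), which meets `W` trivially. [cite: MilnorHusemoller1973, §II.1 and §V.1] -/
theorem sigPos_intersectionForm_add_finrank_le (μ : HomologicalOrientation ℤ X n) (h : k + k = n)
    (W : Submodule ℝ (singularCohomology ℝ ℝ X k))
    (hW : ∀ w ∈ W, w ≠ 0 → kroneckerPairing ℝ ℝ X n (cupProduct h w w)
      (singularHomology.coeffChange X (algebraMap ℤ ℝ : ℤ →+* ℝ).toAddMonoidHom n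
        μ.fundamentalClass) < 0) :
    sigPos (intersectionForm h μ).toQuadraticMap + Module.finrank ℝ W ≤
      Module.finrank ℝ (singularCohomology ℝ ℝ X k) := by
  classical
  obtain ⟨hfin, hfree⟩ :=
    Literature.Topology.FourManifolds.finite_and_free_freeCohomology_int (X := X) (n := n) k
  haveI := hfin
  haveI := hfree
  haveI : Module.Finite ℝ (singularCohomology ℝ ℝ X k) :=
    finite_singularCohomology_of_compact_chartedSpace ℝ ℝ (d := n) k
  set FX := singularHomology.coeffChange X (algebraMap ℤ ℝ : ℤ →+* ℝ).toAddMonoidHom n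
    μ.fundamentalClass with hFX
  -- a Smith frame of a positive definite sublattice of rank `b⁺`
  obtain ⟨r, bM, f, d, hr, hd, hposm⟩ := exists_smithFrame_sigPos (intersectionForm h μ)
  -- lifts of `bM` and their (independent) real images
  choose a ha using fun i ↦ freeCohomology.mk_surjective (R := ℤ) (X := X) (k := k) (bM i)
  have hli := Literature.Topology.FourManifolds.linearIndependent_ringChange_of_basis μ h bM a ha
  -- the real vectors `u j = d j • (a (f j) ⊗ 1)` and their span `U`
  set u : Fin r → singularCohomology ℝ ℝ X k :=
    fun j ↦ (d j : ℝ) • singularCohomology.ringChange (algebraMap ℤ ℝ) X k (a (f j)) with hu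
  have hli_u : LinearIndependent ℝ u := by
    have h1 : LinearIndependent ℝ
        (fun j ↦ singularCohomology.ringChange (algebraMap ℤ ℝ) X k (a (f j))) :=
      hli.comp f f.injective
    have h2 := h1.units_smul fun j ↦ Units.mk0 (d j : ℝ) (by exact_mod_cast hd j)
    convert h2 using 1
    funext j
    rw [Pi.smul_apply', Units.smul_def, Units.val_mk0]
  set U := Submodule.span ℝ (Set.range u) with hUdef
  have hUrank : Module.finrank ℝ U = r := by
    rw [hUdef, finrank_span_eq_card hli_u, Fintype.card_fin]
  -- the integral Gram matrix
  have hGram : ∀ i j, (cupPairing μ h (a (f i)) (a (f j)) : ℝ) =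
      (intersectionForm h μ (bM (f i)) (bM (f j)) : ℝ) := by
    intro i j
    rw [← intersectionForm_mk_mk h μ, ha, ha]
  -- the real pairing is `≥ 0` on `U`
  have hUnonneg : ∀ x ∈ U, 0 ≤ kroneckerPairing ℝ ℝ X n (cupProduct h x x) FX := by
    intro x hx
    obtain ⟨c, rfl⟩ := (Submodule.mem_span_range_iff_exists_fun ℝ).1 hx
    have hx' : (∑ j, c j • u j) = ∑ j, (c j * d j) •
        singularCohomology.ringChange (algebraMap ℤ ℝ) X k (a (f j)) := by
      refine Finset.sum_congr rfl fun j _ ↦ ?_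
      rw [hu, smul_smul]
    rw [hx', hFX, Literature.Topology.FourManifolds.kroneckerPairing_cupProduct_sum_smul_ringChange μ h
      (fun j ↦ a (f j))]
    set G : Fin r → Fin r → ℝ := fun i j ↦
      -((d i * d j * intersectionForm h μ (bM (f i)) (bM (f j)) : ℤ) : ℝ) with hGdef
    have hG : ∀ m : Fin r → ℤ, ∑ i, ∑ j, (m i : ℝ) * (m j : ℝ) * G i j ≤ 0 := by
      intro m
      have h1 : ∑ i, ∑ j, (m i : ℝ) * (m j : ℝ) * G i j =
          -((∑ i, ∑ j, m i * m j * (d i * d j * intersectionForm h μ (bM (f i)) (bM (f j))) : ℤ) : ℝ) := by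
        rw [hGdef]
        push_cast
        rw [← Finset.sum_neg_distrib]
        refine Finset.sum_congr rfl fun i _ ↦ ?_
        rw [← Finset.sum_neg_distrib]
        refine Finset.sum_congr rfl fun j _ ↦ ?_
        ring
      rw [h1, neg_nonpos]
      exact_mod_cast hposm m
    have key := Literature.Topology.FourManifolds.sum_mul_mul_nonpos_of_int G hG c
    have h2 : ∑ i, ∑ j, c i * c j * G i j =
        -∑ i, ∑ j, (c i * d i) * (c j * d j) * (cupPairing μ h (a (f i)) (a (f j)) : ℝ) := by
      rw [← Finset.sum_neg_distrib]
      refine Finset.sum_congr rfl fun i _ ↦ ?_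
      rw [← Finset.sum_neg_distrib]
      refine Finset.sum_congr rfl fun j _ ↦ ?_
      rw [hGram i j, hGdef]
      push_cast
      ring
    rw [h2, neg_nonpos] at key
    exact key
  -- `U ∩ W = 0`
  have hdisj : Disjoint U W := by
    rw [Submodule.disjoint_def]
    intro x hxU hxW
    by_contra hx0
    exact absurd (hW x hxW hx0) (not_lt.2 (hUnonneg x hxU))
  have hle := Submodule.finrank_add_finrank_le_of_disjoint hdisj
  rw [hUrank, ← hr] at hle
  exact hle

/-- **Thom's inequality across `ℤ → ℝ` (positive side)**: for a real subspace `V ⊆ Hᵏ(X; ℝ)` on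
which the real cup pairing is positive definite, `b⁻(Q_X) + dim V ≤ dim Hᵏ(X; ℝ)` (the negative
side for the reversed orientation: `Q_{-X} = -Q_X`, `[X]_{-μ} = -[X]_μ`).
[cite: MilnorHusemoller1973, §II.1 and §V.1] -/
theorem sigNeg_intersectionForm_add_finrank_le (μ : HomologicalOrientation ℤ X n) (h : k + k = n)
    (V : Submodule ℝ (singularCohomology ℝ ℝ X k))
    (hV : ∀ v ∈ V, v ≠ 0 → 0 < kroneckerPairing ℝ ℝ X n (cupProduct h v v)
      (singularHomology.coeffChange X (algebraMap ℤ ℝ : ℤ →+* ℝ).toAddMonoidHom n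
        μ.fundamentalClass)) :
    sigNeg (intersectionForm h μ).toQuadraticMap + Module.finrank ℝ V ≤
      Module.finrank ℝ (singularCohomology ℝ ℝ X k) := by
  have hneg : (-μ).fundamentalClass = -μ.fundamentalClass :=
    HomologicalOrientation.fundamentalClass_neg_holds (R := ℤ) (X := X) n μ
  have hQ : intersectionForm h (-μ) = -intersectionForm h μ := by
    ext x y
    induction x using freeCohomology.induction_on with
    | h a =>
      induction y using freeCohomology.induction_on with
      | h b =>
        simp only [LinearMap.neg_apply, intersectionForm_mk_mk, cupPairing_apply, hneg, map_neg]
  have key := sigPos_intersectionForm_add_finrank_le (-μ) h V (fun v hv hv0 ↦ by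
    rw [hneg, map_neg, map_neg, neg_lt_zero]
    exact hV v hv hv0)
  rw [hQ] at key
  have hq : (-intersectionForm h μ).toQuadraticMap = -(intersectionForm h μ).toQuadraticMap := rfl
  rwa [hq, sigPos_neg] at key

end Lattice

/-! ### Part B: the complex orientation and the Kronecker functional -/

section ComplexOrientation

variable {E : Type*} [NormedAddCommGroup E] [NormedSpace ℂ E] [FiniteDimensional ℂ E]
  {M : Type*} [TopologicalSpace M] [ChartedSpace E M] [IsManifold 𝓘(ℂ, E) ω M]
  [IsManifold 𝓘(ℝ, E) ∞ M] [T2Space M] [CompactSpace M]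

/-- **`∫_M ω^d > 0` for a constant orientation family**, in any prescribed spelling `n` of the
real dimension `2d` (the tree's `exists_orientation_integral_kaehlerFormPow_pos`, Voisin (2002)
§3.1.3 Lemma 3.8, transported along `2 * finrank ℂ E = n`). [cite: VoisinHodgeI2002, §3.1.3 Lemma 3.8] -/
theorem exists_orientation_integral_kaehlerFormPow_castDeg_pos {n : ℕ} [Fact (finrank ℝ E = n)]
    [Nonempty M] [MeasurableSpace E] [BorelSpace E] (h2d : 2 * finrank ℂ E = n)
    (g : Bundle.ContMDiffRiemannianMetric 𝓘(ℝ, E) ∞ E (fun x : M ↦ TangentSpace 𝓘(ℝ, E) x))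
    (hg : g.toRiemannianMetric.IsHermitian) :
    ∃ o₀ : Orientation ℝ E (Fin n), IsContinuousOrientation (I := 𝓘(ℝ, E)) (M := M) (fun _ ↦ o₀) ∧
      0 < ((kaehlerFormPow g.toRiemannianMetric (finrank ℂ E)).castDeg h2d).integral
        (fun _ : M ↦ o₀) := by
  subst h2d
  obtain ⟨o₀, ho, hpos⟩ := exists_orientation_integral_kaehlerFormPow_pos (M := M) g hg
  exact ⟨o₀, ho, by rwa [MForm.castDeg_rfl]⟩

end ComplexOrientation

section Unit

variable {E : Type*} [NormedAddCommGroup E] [NormedSpace ℂ E]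
  {M : Type*} [TopologicalSpace M] [ChartedSpace E M]

/-- **`ω⁰` is a right unit of the wedge**: `β ∧ ω⁰ = β` up to the degree cast `l = l + 2·0`
(`ω⁰ = 1`, `kaehlerFormPow_zero`; from `1 ∧ β = β`, `ContinuousAlternatingMap.constOfIsEmpty_one_wedge`,
and graded commutativity, Warner (1983), 2.6). [folklore] -/
theorem wedge_kaehlerFormPow_zero (g : Bundle.RiemannianMetric (fun x : M ↦ TangentSpace 𝓘(ℝ, E) x))
    {l : ℕ} (h : l = l + 2 * 0) (β : MForm 𝓘(ℝ, E) M ℝ l) :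
    β.wedge (kaehlerFormPow g 0) = β.castDeg h := by
  funext x
  have h0 : ((kaehlerFormPow g 0) x : E [⋀^Fin 0]→L[ℝ] ℝ) =
      ContinuousAlternatingMap.constOfIsEmpty ℝ E (Fin 0) (1 : ℝ) := by
    ext w; rfl
  have key : ∀ (c : E [⋀^Fin 0]→L[ℝ] ℝ) (b : E [⋀^Fin l]→L[ℝ] ℝ),
      c = ContinuousAlternatingMap.constOfIsEmpty ℝ E (Fin 0) (1 : ℝ) →
        ∀ w : Fin (l + 0) → E, b.wedge c w = b (fun i ↦ w (Fin.cast (Nat.add_zero l).symm i)) := by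
    rintro c b rfl w
    rw [ContinuousAlternatingMap.WedgeComm_holds ℝ E ℝ
      (ContinuousAlternatingMap.constOfIsEmpty ℝ E (Fin 0) (1 : ℝ)) b, zero_mul, pow_zero, one_smul,
      ContinuousAlternatingMap.constOfIsEmpty_one_wedge, ContinuousAlternatingMap.domDomCongr_apply,
      ContinuousAlternatingMap.domDomCongr_apply]
    rfl
  ext v
  rw [MForm.castDeg_apply, MForm.wedge_apply]
  exact key _ _ h0 _

/-- `(α.castDeg h) ∧ β = (α ∧ β).castDeg _`. [folklore] -/
theorem castDeg_wedge_left {A : Type*} [NormedCommRing A] [NormedAlgebra ℝ A] {k k' l : ℕ}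
    (h : k = k') (α : MForm 𝓘(ℝ, E) M A k) (β : MForm 𝓘(ℝ, E) M A l) :
    (α.castDeg h).wedge β = (α.wedge β).castDeg (by rw [h]) := by
  subst h; rfl

/-- `α ∧ (β.castDeg h) = (α ∧ β).castDeg _`. [folklore] -/
theorem castDeg_wedge_right {A : Type*} [NormedCommRing A] [NormedAlgebra ℝ A] {k l l' : ℕ}
    (h : l = l') (α : MForm 𝓘(ℝ, E) M A k) (β : MForm 𝓘(ℝ, E) M A l) :
    α.wedge (β.castDeg h) = (α.wedge β).castDeg (by rw [h]) := by
  subst h; rfl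

/-- `α.castDeg h = 0 ↔ α = 0`. [folklore] -/
theorem castDeg_eq_zero_iff {F : Type*} [NormedAddCommGroup F] [NormedSpace ℝ F] {k k' : ℕ}
    (h : k = k') (α : MForm 𝓘(ℝ, E) M F k) : α.castDeg h = 0 ↔ α = 0 := by
  subst h; exact Iff.rfl

end Unit

section TopFunctional

open Literature.Geometry.Manifold

variable {d : ℕ} {X : Motives.SchemeOver ℂ}

/-- **`⟨y, [X(ℂ)]_μ ⊗ 1⟩ = K · ∫_M t` for all closed top forms `t` of the analytification, with one
constant `K > 0`**, as soon as ONE closed top form `t₀` has both `∫_M t₀ > 0` and a positively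
pairing class. Here `φ^* y = e[t]` for a real de Rham isomorphism family `e` and the
analytification `φ : M = X^an → X(ℂ)`, and `o` is a continuous orientation family on `M`. Proof:
`H²ᵈ(X(ℂ); ℝ)` is the line spanned by the Kronecker dual of `[X(ℂ)]`
(`eq_smul_ringChange_of_kroneckerPairing_eq_one`), so `T(t₀) • [t] = T(t) • [t₀]` in de Rham
cohomology, i.e. `T(t₀) t − T(t) t₀` is exact and integrates to `0` (Stokes,
`MForm.integral_eq_zero_of_mem_exactSmoothForms_holds`), whence `T(t) = (T(t₀)/∫t₀) ∫ t`.
[cite: LeeSmoothManifolds2013, Thm. 17.31 and Thm. 18.14] [cite: HatcherAT2002, §3.3 Thm. 3.26 (a)] -/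
theorem exists_kroneckerPairing_eq_mul_integral (hX : Motives.IsSmoothProjective d X)
    (A : HodgeTheory.HodgeModel d X) [Fact (finrank ℝ A.model = 2 * d)] [MeasurableSpace A.model]
    [BorelSpace A.model] (e : DeRhamIsoFamily 𝓘(ℝ, A.model))
    (μ : HomologicalOrientation ℤ (Motives.ComplexPoints X) (2 * d))
    (o : (x : A.carrier) → Orientation ℝ (TangentSpace 𝓘(ℝ, A.model) x) (Fin (2 * d)))
    (ho : IsContinuousOrientation o)
    {t₀ : MForm 𝓘(ℝ, A.model) A.carrier ℝ (2 * d)}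
    (ht₀ : t₀ ∈ closedSmoothForms 𝓘(ℝ, A.model) A.carrier ℝ (2 * d)) (hI₀ : 0 < t₀.integral o)
    {y₀ : singularCohomology ℝ ℝ (Motives.ComplexPoints X) (2 * d)}
    (hy₀ : singularCohomology.map ℝ ℝ
        ⟨A.toComplexPoints, A.isAnalytification.isHomeomorph.continuous⟩ (2 * d) y₀ =
      e A.carrier (2 * d) (deRhamCohomology.mk ⟨t₀, ht₀⟩))
    (hT₀ : 0 < kroneckerPairing ℝ ℝ (Motives.ComplexPoints X) (2 * d) y₀
      (singularHomology.coeffChange (Motives.ComplexPoints X)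
        (algebraMap ℤ ℝ : ℤ →+* ℝ).toAddMonoidHom (2 * d) μ.fundamentalClass)) :
    ∃ K : ℝ, 0 < K ∧ ∀ (t : MForm 𝓘(ℝ, A.model) A.carrier ℝ (2 * d))
      (ht : t ∈ closedSmoothForms 𝓘(ℝ, A.model) A.carrier ℝ (2 * d))
      (y : singularCohomology ℝ ℝ (Motives.ComplexPoints X) (2 * d)),
      singularCohomology.map ℝ ℝ
          ⟨A.toComplexPoints, A.isAnalytification.isHomeomorph.continuous⟩ (2 * d) y =
        e A.carrier (2 * d) (deRhamCohomology.mk ⟨t, ht⟩) →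
      kroneckerPairing ℝ ℝ (Motives.ComplexPoints X) (2 * d) y
        (singularHomology.coeffChange (Motives.ComplexPoints X)
          (algebraMap ℤ ℝ : ℤ →+* ℝ).toAddMonoidHom (2 * d) μ.fundamentalClass) =
        K * t.integral o := by
  classical
  letI := hX.chartedSpace
  haveI := Motives.ComplexPoints.compactSpace_of_isSmoothProjective hX
  haveI := Motives.ComplexPoints.t2Space_of_isSmoothProjective hX
  haveI := HodgeTheory.connectedSpace_complexPoints hX
  haveI : CompactSpace A.carrier := A.compactSpace_carrier hX
  set FX := singularHomology.coeffChange (Motives.ComplexPoints X)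
    (algebraMap ℤ ℝ : ℤ →+* ℝ).toAddMonoidHom (2 * d) μ.fundamentalClass with hFX
  obtain ⟨g, hg1, -⟩ := exists_integral_orientation_generator_top hX μ
  set T₀ := kroneckerPairing ℝ ℝ (Motives.ComplexPoints X) (2 * d) y₀ FX with hT₀def
  refine ⟨T₀ / t₀.integral o, div_pos hT₀ hI₀, fun t ht y hy ↦ ?_⟩
  set T := kroneckerPairing ℝ ℝ (Motives.ComplexPoints X) (2 * d) y FX with hTdef
  -- `y = T • G`, `y₀ = T₀ • G` for the Kronecker dual `G = g ⊗ 1`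
  have hyG := eq_smul_ringChange_of_kroneckerPairing_eq_one μ hg1 y
  have hy₀G := eq_smul_ringChange_of_kroneckerPairing_eq_one μ hg1 y₀
  rw [← hFX, ← hTdef] at hyG
  rw [← hFX, ← hT₀def] at hy₀G
  have hyy : T₀ • y = T • y₀ := by
    conv_lhs => rw [hyG]
    conv_rhs => rw [hy₀G]
    rw [smul_smul, smul_smul, mul_comm T₀ T]
  -- hence `T₀ • [t] = T • [t₀]` in de Rham cohomology
  have hdR : T₀ • deRhamCohomology.mk ⟨t, ht⟩ = T • deRhamCohomology.mk ⟨t₀, ht₀⟩ := by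
    apply (e A.carrier (2 * d)).injective
    rw [map_smul, map_smul, ← hy, ← hy₀, ← map_smul, ← map_smul, hyy]
  -- so `T₀ • t - T • t₀` is exact, and integrates to zero
  have hex : T₀ • t + (-T) • t₀ ∈ Literature.Geometry.Kaehler.exactSmoothForms 𝓘(ℝ, A.model)
      A.carrier ℝ (2 * d) := by
    have h0 : deRhamCohomology.mk (T₀ • (⟨t, ht⟩ : closedSmoothForms 𝓘(ℝ, A.model) A.carrier ℝ
        (2 * d)) + (-T) • ⟨t₀, ht₀⟩) = 0 := by
      rw [map_add, map_smul, map_smul, hdR, neg_smul, add_neg_cancel]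
    exact mem_exactSmoothForms_of_mk_eq_zero _ h0
  have hint0 : (T₀ • t + (-T) • t₀).integral o = 0 :=
    MForm.integral_eq_zero_of_mem_exactSmoothForms_holds o ho hex
  have hts : IsSmoothForm t := ((Literature.Geometry.Kaehler.mem_closedSmoothForms_iff t).1 ht).1
  have ht₀s : IsSmoothForm t₀ :=
    ((Literature.Geometry.Kaehler.mem_closedSmoothForms_iff t₀).1 ht₀).1
  rw [MForm.integral_add_holds o ho (hts.smul T₀) (ht₀s.smul (-T)), MForm.integral_smul,
    MForm.integral_smul] at hint0
  -- solve for `T`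
  field_simp
  linarith

end TopFunctional

/-! ### Part C: Hodge index negativity for primitive real `(1,1)`-classes -/

section HodgeIndex

open Literature.Geometry.Manifold
open Literature.AlgebraicGeometry.HodgeTheory (complexifyFun ofRealClass conjClass)

variable {X : Motives.SchemeOver ℂ}

/-- **The Hodge index inequality WITH SIGN** (Voisin I Thm. 6.32 at `k = 2`, `(p,q) = (1,1)`;
Huybrechts (2005) Prop. 3.3.15; Hartshorne V.1.9), on the tree's carriers. Let `X` be a smooth
projective surface with Hodge model `A` (the compact Kähler surface `M = X^an` with analytification
`φ`), `e` a natural multiplicative real de Rham isomorphism family, `g` a smooth Kähler metric on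
`M` with Kähler form `ω` and singular Kähler class `κ` (`φ^* κ = e[ω]`), `o` an orientation family
with smooth volume form normalised by `∫_M ω² > 0`, and `μ` a homological `ℤ`-orientation of
`X(ℂ)` whose Kronecker functional on top classes is `K · ∫_M` with `K > 0`. Then every non-zero
real class `y ∈ H²(X(ℂ); ℝ)` whose complexification is of Hodge type `(1,1)` and which is primitive
(`y ∪ κ = 0`) has NEGATIVE square: `⟨y ∪ y, [X(ℂ)]_μ ⊗ 1⟩ < 0`. Printed proof (Huybrechts p. 163 /
Voisin p. 129): represent `e⁻¹ φ^* y` by its harmonic form `β` (Hodge's theorem,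
`existsUnique_isHarmonicForm_mk_eq_of_compact_of_isKaehler`); `ω ∧ β` is harmonic (`[L, Δ] = 0`,
`isHarmonicForm_kaehlerForm_wedge`) and represents `κ ∪ y = 0`, hence vanishes, so `β` is primitive
at every point; `β ⊗ 1` is a `Δ_∂̄`-harmonic `(1,1)`-form (`isOfType_of_isCHarmonicForm_of_mk_eq`,
`Δ_d = 2Δ_∂̄`), so the Hodge–Riemann bilinear relation for `(M, g, o)` (hypothesis `hHRB`, i.e. the
tree's theorem `hodge_riemann_bilinear_holds o g`; pointwise Cor. 1.2.36) gives `∫_M β ∧ β < 0`, and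
`⟨y ∪ y, [X(ℂ)] ⊗ 1⟩ = K ∫_M β ∧ β`.
[cite: VoisinHodgeI2002, §6.3.2 Thm. 6.32] [cite: Huybrechts2005, Prop. 3.3.15] -/
theorem kroneckerPairing_cupProduct_self_neg_of_isOfHodgeType_oneOne
    (hX : Motives.IsSmoothProjective 2 X) (A : HodgeTheory.HodgeModel 2 X)
    [Fact (finrank ℝ A.model = 2 * 2)] [MeasurableSpace A.model] [BorelSpace A.model]
    (e : DeRhamIsoFamily 𝓘(ℝ, A.model)) (he : e.IsNatural) (hem : e.IsMultiplicative)
    (μ : HomologicalOrientation ℤ (Motives.ComplexPoints X) (2 * 2))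
    (g : Bundle.ContMDiffRiemannianMetric 𝓘(ℝ, A.model) ∞ A.model
      (fun x : A.carrier ↦ TangentSpace 𝓘(ℝ, A.model) x))
    (hg : g.toRiemannianMetric.IsKaehler)
    (o : (x : A.carrier) → Orientation ℝ (TangentSpace 𝓘(ℝ, A.model) x) (Fin (2 * 2)))
    (hvol : letI : RiemannianBundle (fun x : A.carrier ↦ TangentSpace 𝓘(ℝ, A.model) x) :=
        ⟨g.toRiemannianMetric⟩
      IsSmoothForm (riemannianVolumeForm o))
    (hHRB : hodge_riemann_bilinear o g)
    (h2d : 2 * finrank ℂ A.model = 2 * 2)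
    (hωpos : 0 < ((kaehlerFormPow g.toRiemannianMetric (finrank ℂ A.model)).castDeg h2d).integral o)
    {K : ℝ} (hK : 0 < K)
    (hTK : ∀ (t : MForm 𝓘(ℝ, A.model) A.carrier ℝ (2 * 2))
      (ht : t ∈ closedSmoothForms 𝓘(ℝ, A.model) A.carrier ℝ (2 * 2))
      (z : singularCohomology ℝ ℝ (Motives.ComplexPoints X) (2 * 2)),
      singularCohomology.map ℝ ℝ
          ⟨A.toComplexPoints, A.isAnalytification.isHomeomorph.continuous⟩ (2 * 2) z =
        e A.carrier (2 * 2) (deRhamCohomology.mk ⟨t, ht⟩) →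
      kroneckerPairing ℝ ℝ (Motives.ComplexPoints X) (2 * 2) z
        (singularHomology.coeffChange (Motives.ComplexPoints X)
          (algebraMap ℤ ℝ : ℤ →+* ℝ).toAddMonoidHom (2 * 2) μ.fundamentalClass) =
        K * t.integral o)
    (hω : g.toRiemannianMetric.kaehlerForm ∈ closedSmoothForms 𝓘(ℝ, A.model) A.carrier ℝ 2)
    {κ : singularCohomology ℝ ℝ (Motives.ComplexPoints X) (2 * 1)}
    (hκ : singularCohomology.map ℝ ℝ
        ⟨A.toComplexPoints, A.isAnalytification.isHomeomorph.continuous⟩ (2 * 1) κ =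
      e A.carrier (2 * 1) (deRhamCohomology.mk ⟨g.toRiemannianMetric.kaehlerForm, hω⟩))
    {y : singularCohomology ℝ ℝ (Motives.ComplexPoints X) (2 * 1)} (hy0 : y ≠ 0)
    (hy11 : HodgeTheory.IsOfHodgeType 2 X (2 * 1) 1 1 (ofRealClass (Motives.ComplexPoints X) (2 * 1) y))
    (hyκ : cupProduct (rfl : 2 * 1 + 2 * 1 = 2 * 2) κ y = 0) :
    kroneckerPairing ℝ ℝ (Motives.ComplexPoints X) (2 * 2)
        (cupProduct (rfl : 2 * 1 + 2 * 1 = 2 * 2) y y)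
        (singularHomology.coeffChange (Motives.ComplexPoints X)
          (algebraMap ℤ ℝ : ℤ →+* ℝ).toAddMonoidHom (2 * 2) μ.fundamentalClass) < 0 := by
  classical
  letI := hX.chartedSpace
  haveI := Motives.ComplexPoints.compactSpace_of_isSmoothProjective hX
  haveI := Motives.ComplexPoints.t2Space_of_isSmoothProjective hX
  haveI := HodgeTheory.connectedSpace_complexPoints hX
  haveI : CompactSpace A.carrier := A.compactSpace_carrier hX
  haveI : ConnectedSpace A.carrier :=
    A.isAnalytification.homeomorph.symm.surjective.connectedSpace
      A.isAnalytification.homeomorph.symm.continuous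
  have hfin : finrank ℂ A.model = 2 := A.isAnalytification.finrank_eq
  haveI : WedgeFacts 𝓘(ℝ, A.model) A.carrier ℝ :=
    wedgeFacts_of_assoc 𝓘(ℝ, A.model) A.carrier ℝ (ContinuousAlternatingMap.WedgeAssoc_holds ℝ A.model ℝ)
  haveI : WedgeFacts 𝓘(ℝ, A.model) A.carrier ℂ :=
    wedgeFacts_of_assoc 𝓘(ℝ, A.model) A.carrier ℂ (ContinuousAlternatingMap.WedgeAssoc_holds ℝ A.model ℂ)
  letI : RiemannianBundle (fun x : A.carrier ↦ TangentSpace 𝓘(ℝ, A.model) x) := ⟨g.toRiemannianMetric⟩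
  haveI : IsContMDiffRiemannianBundle 𝓘(ℝ, A.model) ∞ A.model
      (fun x : A.carrier ↦ TangentSpace 𝓘(ℝ, A.model) x) := ⟨g.inner, g.contMDiff, fun _ _ _ ↦ rfl⟩
  haveI : IsContinuousRiemannianBundle A.model (fun x : A.carrier ↦ TangentSpace 𝓘(ℝ, A.model) x) :=
    ⟨g.inner, g.contMDiff.continuous, fun _ _ _ ↦ rfl⟩
  -- notation
  set φ : C(A.carrier, Motives.ComplexPoints X) :=
    ⟨A.toComplexPoints, A.isAnalytification.isHomeomorph.continuous⟩ with hφ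
  set ωK := g.toRiemannianMetric.kaehlerForm with hωK
  have h22 : 2 * 1 + 2 * 1 = 2 * 2 := rfl
  have hdeg : 2 * 1 + (2 * 1 + 2 * 0) = 2 * 2 := rfl
  -- the real de Rham class `c` with `e c = φ^* y` and its harmonic representative `β`
  obtain ⟨c, hc⟩ := (e A.carrier (2 * 1)).surjective (singularCohomology.map ℝ ℝ φ (2 * 1) y)
  obtain ⟨⟨β, hβ⟩, ⟨hβH, hβc⟩, -⟩ :=
    existsUnique_isHarmonicForm_mk_eq_of_compact_of_isKaehler g o hg (2 * 1) (2 * 1 + 2 * 0) hvol hdeg c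
  have hβs : IsSmoothForm β := hβ.1
  -- (1) `ω ∧ β = 0`: it is harmonic and represents `κ ∪ y = 0`
  have h4 : 2 * 2 + 0 = 2 * 2 := rfl
  have hc2 : 2 + 2 * 1 = 2 * 2 := rfl
  have hωβH : IsHarmonicForm o h4 ((ωK.wedge β).castDeg hc2) :=
    isHarmonicForm_kaehlerForm_wedge g o hg hc2 hdeg h4 hvol hβH
  have hωβ0 : (ωK.wedge β).castDeg hc2 = 0 := by
    -- the closed form `ω ∧ β` as an element of `Z^{2·2}`, with class `[ω] ⌣ [β]`
    set W : closedSmoothForms 𝓘(ℝ, A.model) A.carrier ℝ (2 * 2) :=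
      deRhamCohomology.closedWedge h22 ⟨ωK, hω⟩ ⟨β, hβ⟩ with hWdef
    have hWcoe : (W : MForm 𝓘(ℝ, A.model) A.carrier ℝ (2 * 2)) = (ωK.wedge β).castDeg hc2 := rfl
    have hWmk : deRhamCohomology.mk W = 0 := by
      apply (e A.carrier (2 * 2)).injective
      rw [hWdef, ← deRhamCohomology.cup_mk_mk, hem A.carrier (2 * 1) (2 * 1) (2 * 2) h22, hβc, hc,
        ← hκ, ← cupProduct_map, hyκ, map_zero, map_zero]
    obtain ⟨W₀, -, huniq⟩ :=
      existsUnique_isHarmonicForm_mk_eq_of_compact_of_isKaehler g o hg (2 * 2) 0 hvol h4 0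
    have h1 : W = W₀ := huniq W ⟨hWcoe ▸ hωβH, hWmk⟩
    have h2 : (0 : closedSmoothForms 𝓘(ℝ, A.model) A.carrier ℝ (2 * 2)) = W₀ :=
      huniq 0 ⟨Literature.Geometry.Kaehler.isHarmonicForm_zero o h4, map_zero _⟩
    rw [← hWcoe, h1, ← h2]
    rfl
  have hωβ : ωK.wedge β = 0 := (castDeg_eq_zero_iff hc2 _).1 hωβ0
  -- (2) primitivity in the `L`-form: `β ∧ ω^1 = 0`
  have hprimℝ : β.wedge (kaehlerFormPow g.toRiemannianMetric 1) = 0 := by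
    rw [kaehlerFormPow_one, castDeg_wedge_right, MForm.wedge_comm, hωβ, MForm.castDeg_zero,
      smul_zero, MForm.castDeg_zero]
  -- (3) the complexification `γ = β ⊗ 1`: `Δ_d`-harmonic, of type `(1,1)`, `Δ_∂̄`-harmonic
  set γ : MForm 𝓘(ℝ, A.model) A.carrier ℂ (2 * 1) := β.ofReal with hγdef
  have hγc : γ ∈ cclosedSmoothForms A.model A.carrier (2 * 1) := ofReal_mem_cclosedSmoothForms hβ
  have hγs : IsSmoothForm γ := hβs.ofReal
  have hγH : IsCHarmonicForm o hdeg γ := (isHarmonicForm_iff_isCHarmonicForm_ofReal o hdeg β).1 hβH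
  -- the complex class of `γ` is `ofReal c`, which lies in `H^{1,1}` (model independence of types)
  have hKI := cHodgeLaplacian_eq_two_smul_dolbeaultLaplacian_of_isManifold_complex_of_t2Space
    (k := 2 * 1) (m := 2 * 1 + 2 * 0) g o
  let A' : HodgeTheory.HodgeModel 2 X :=
    { A with
      deRham := e.complexify
      deRham_isNatural := DeRhamIsoFamily.complexify_isNatural he }
  have hmem : complexDeRhamCohomology.ofReal A.model A.carrier (2 * 1) c ∈
      hodgePQ A.model A.carrier (2 * 1) 1 1 := by
    have h1 := hy11.mem_hodgePQ hX A'
    change singularCohomology.map ℂ ℂ φ (2 * 1) (ofRealClass (Motives.ComplexPoints X) (2 * 1) y) ∈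
      (hodgePQ A.model A.carrier (2 * 1) 1 1).map (e.complexify A.carrier (2 * 1)).toLinearMap at h1
    rw [← HodgeTheory.ofRealClass_map, ← hc, ← HodgeTheory.complexifyFun_ofReal] at h1
    obtain ⟨w, hw, hweq⟩ := Submodule.mem_map.1 h1
    have : w = complexDeRhamCohomology.ofReal A.model A.carrier (2 * 1) c :=
      (e.complexifyEquiv A.carrier (2 * 1)).injective hweq
    rwa [this] at hw
  have hmk : complexDeRhamCohomology.mk A.model A.carrier (2 * 1) ⟨γ, hγc⟩ =
      complexDeRhamCohomology.ofReal A.model A.carrier (2 * 1) c := by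
    rw [← hβc, complexDeRhamCohomology.ofReal_mk]
  obtain ⟨⟨γ', hγ'c⟩, hγ't, hγ'mk⟩ := exists_isOfType_mk_eq_of_mem_hodgePQ (p := 1) (q := 1) rfl hmem
  have hγt : IsOfType 1 1 γ :=
    isOfType_of_isCHarmonicForm_of_mk_eq g o hKI hg (p := 1) (q := 1) rfl hdeg hγ'c hγ't hγc
      (hmk.trans hγ'mk.symm) hvol hγH
  have hΔbar : dolbeaultLaplacian o (2 * 1) (2 * 1 + 2 * 0) hdeg γ = 0 := by
    have h0 := hγH.2
    rw [hKI hg hdeg hγs hvol] at h0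
    exact (smul_eq_zero.1 h0).resolve_left two_ne_zero
  have hγD : γ ∈ dolbeaultHarmonicForms o 1 1 hdeg := Submodule.subset_span ⟨hγs, hγt, hΔbar⟩
  -- `γ ≠ 0`
  have hγ0 : γ ≠ 0 := by
    intro h0
    have hβ0 : β = 0 := by rw [← MForm.re_ofReal β, ← hγdef, h0, MForm.re_zero]
    apply hy0
    have hc0 : c = 0 := by
      rw [← hβc]
      have : (⟨β, hβ⟩ : closedSmoothForms 𝓘(ℝ, A.model) A.carrier ℝ (2 * 1)) = 0 := Subtype.ext hβ0
      rw [this, map_zero]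
    have hinj : Function.Injective (singularCohomology.map ℝ ℝ φ (2 * 1)) :=
      (singularCohomology.mapIso ℝ ℝ A.isAnalytification.homeomorph (2 * 1)).toLinearEquiv.injective
    apply hinj
    rw [map_zero, ← hc, hc0, map_zero]
  -- primitivity of `γ`
  have hprim : γ.wedge (kaehlerFormPow g.toRiemannianMetric (0 + 1)).ofReal = 0 := by
    show γ.wedge (kaehlerFormPow g.toRiemannianMetric 1).ofReal = 0
    rw [hγdef, ← MForm.ofReal_wedge, hprimℝ, MForm.ofReal_zero]
  -- (4) Hodge–Riemann: `∫ β ∧ β < 0`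
  have hkr : 2 * 1 + 0 = finrank ℂ A.model := by rw [hfin]
  obtain ⟨hHR, -⟩ := hHRB hg (p := 1) (q := 1) (k := 2 * 1) (r := 0) hkr h2d hdeg hvol hωpos hγD
    hprim hγ0
  have hsign : Complex.I ^ (((1 : ℕ) : ℤ) - (1 : ℕ)) * (-1 : ℂ) ^ (2 * 1 * (2 * 1 - 1) / 2) = -1 := by
    norm_num
  rw [hsign, neg_one_mul, Complex.neg_re, re_cintegral] at hHR
  -- the integrand is `β ∧ β`
  have hΓ : ((γ.wedge (γ.conj.wedge (kaehlerFormPow g.toRiemannianMetric 0).ofReal)).castDeg hdeg).re =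
      (β.wedge β).castDeg h22 := by
    have e0 : 2 * 1 = 2 * 1 + 2 * 0 := rfl
    rw [hγdef, MForm.conj_ofReal, ← MForm.ofReal_wedge, wedge_kaehlerFormPow_zero _ e0,
      MForm.ofReal_castDeg, castDeg_wedge_right, MForm.castDeg_castDeg, ← MForm.ofReal_wedge,
      ← MForm.ofReal_castDeg, MForm.re_ofReal]
  rw [hΓ] at hHR
  -- (5) `⟨y ∪ y, [X(ℂ)] ⊗ 1⟩ = K ∫ β ∧ β`
  have hββ : (β.wedge β).castDeg h22 ∈ closedSmoothForms 𝓘(ℝ, A.model) A.carrier ℝ (2 * 2) :=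
    (deRhamCohomology.closedWedge h22 ⟨β, hβ⟩ ⟨β, hβ⟩).2
  have hyy : singularCohomology.map ℝ ℝ φ (2 * 2) (cupProduct h22 y y) =
      e A.carrier (2 * 2) (deRhamCohomology.mk ⟨(β.wedge β).castDeg h22, hββ⟩) := by
    rw [cupProduct_map, ← hc, ← hem A.carrier (2 * 1) (2 * 1) (2 * 2) h22, ← hβc,
      deRhamCohomology.cup_mk_mk]
    rfl
  rw [hTK _ hββ _ hyy]
  exact mul_neg_of_pos_of_neg hK (by linarith)

end HodgeIndex

/-! ### Part D: the signature of a K3 surface for the complex orientation -/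

section K3Signature

open Literature.Geometry.Manifold
open Literature.AlgebraicGeometry.HodgeTheory (complexifyFun ofRealClass conjClass reClass imClass)

variable {S : Motives.SchemeOver ℂ}

/-- **`ω^d` in the spelling `d = 2`**: `(ω^{dim}).castDeg = (ω ∧ ω).castDeg` on a complex surface
(transport along `finrank ℂ E = 2`, then `ω² = ω¹ ∧ ω`, `ω¹ = ω`). [folklore] -/
theorem kaehlerFormPow_finrank_castDeg_eq {E : Type*} [NormedAddCommGroup E] [NormedSpace ℂ E]
    {M : Type*} [TopologicalSpace M] [ChartedSpace E M]
    (g : Bundle.RiemannianMetric (fun x : M ↦ TangentSpace 𝓘(ℝ, E) x)) {n : ℕ}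
    (hd : finrank ℂ E = 2) (h2d : 2 * finrank ℂ E = n) (h22 : 2 + 2 = n) :
    (kaehlerFormPow g (finrank ℂ E)).castDeg h2d = (g.kaehlerForm.wedge g.kaehlerForm).castDeg h22 := by
  have key : ∀ (d : ℕ) (hd' : finrank ℂ E = d) (h2d' : 2 * d = n),
      (kaehlerFormPow g (finrank ℂ E)).castDeg h2d = (kaehlerFormPow g d).castDeg h2d' := by
    rintro d rfl h2d'
    rfl
  rw [key 2 hd (by omega), kaehlerFormPow_succ, kaehlerFormPow_one, castDeg_wedge_left,
    MForm.castDeg_castDeg, MForm.castDeg_castDeg]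

set_option maxHeartbeats 1600000 in -- one long assembly; see the module docstring
/-- **The engine of clause (i).** For a K3 surface `S` with `b₂(S) = 22`, a Hodge model `A`
carrying the nowhere-vanishing holomorphic `2`-form `η`, and a natural multiplicative real de Rham
isomorphism family `e`, there is a `ℤ`-orientation `μ` of `S(ℂ)` (the complex one) with the
Hodge–Riemann positivity (ii) on `H^{2,0}` AND `τ(S(ℂ), μ) = b⁺ − b⁻ = −16`. Printed proof: Huybrechts,
*Lectures on K3 Surfaces*, Ch. 1, proof of Prop. 3.5 (p. 24: "of index `−16` … signature `(3, 19)`"),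
with the index computed by the Hodge index theorem (Voisin I Thm. 6.32/6.33: positive definite on
`(H^{2,0} ⊕ H^{0,2})_ℝ ⊕ ℝκ`, negative definite on the primitive real `(1,1)`-classes) instead of
Thom–Hirzebruch. On the tree's carriers: over `ℝ`, `Re σ`, `Im σ` and the Kähler class `κ` span a
positive definite `3`-space `V` (`(σ.σ̄) > 0` — clause (ii) —, `σ² = 0` —
`IsK3Surface.cupProduct_twoZero_self` —, `κ² > 0`, `κ ⊥ σ` by type — `Huybrechts_K3_hodgeTypes_H2_holds`
(3)); its orthogonal `W` (dimension `≥ 22 − 3`) consists of real primitive classes whose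
complexification is of type `(1,1)` (ibid.), on which the form is negative definite
(`kroneckerPairing_cupProduct_self_neg_of_isOfHodgeType_oneOne`); Thom's inequalities across
`ℤ → ℝ` (`sigPos_intersectionForm_add_finrank_le`, `sigNeg_intersectionForm_add_finrank_le`) and
`b₂ = b⁺ + b⁻` (`finrank_eq_sigPos_add_sigNeg_intersectionForm_holds`) give `(b⁺, b⁻) = (3, b₂ − 3)`.
(Appended in v2 as the `b₂`-free form of the engine below; with `b₂ = 22` it gives `−16`.)
[cite: Huybrechts2016K3, Ch. 1 Prop. 3.5, proof (p. 24); Ch. 6 Prop. 1.2] [cite: VoisinHodgeI2002, §6.3.2 Thm. 6.32 and Thm. 6.33] -/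
theorem IsK3Surface.exists_orientation_hodgeRiemann_signature_eq (hS : IsK3Surface S)
    (A : HodgeTheory.HodgeModel 2 S) {η : MForm 𝓘(ℝ, A.model) A.carrier ℂ 2}
    (hη : Literature.Geometry.Kaehler.IsHolomorphicInCharts η) (hη0 : ∀ x, η x ≠ 0)
    (e : DeRhamIsoFamily 𝓘(ℝ, A.model)) (he : e.IsNatural) (hem : e.IsMultiplicative) :
    ∃ μ : HomologicalOrientation ℤ (Motives.ComplexPoints S) (2 * 2),
      (∀ σ : HodgeTheory.complexBetti S (2 * 1), HodgeTheory.IsOfHodgeType 2 S (2 * 1) 2 0 σ →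
        σ ≠ 0 → ∀ g : singularCohomology ℤ ℤ (Motives.ComplexPoints S) (2 * 2),
          kroneckerPairing ℤ ℤ (Motives.ComplexPoints S) (2 * 2) g μ.fundamentalClass = 1 →
            ∃ c : ℂ, 0 < c.re ∧
              cupProduct (rfl : 2 * 1 + 2 * 1 = 2 * 2)
                (HodgeTheory.conjClass (Motives.ComplexPoints S) (2 * 1) σ) σ =
                  c • singularCohomology.ringChange (algebraMap ℤ ℂ) (Motives.ComplexPoints S)
                    (2 * 2) g) ∧
      (intersectionForm (rfl : 2 * 1 + 2 * 1 = 2 * 2) μ).signature =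
        6 - (Module.finrank ℂ (HodgeTheory.complexBetti S (2 * 1)) : ℤ) := by
  have hX := hS.isSmoothProjective
  letI := hX.chartedSpace
  haveI := Motives.ComplexPoints.compactSpace_of_isSmoothProjective hX
  haveI := Motives.ComplexPoints.t2Space_of_isSmoothProjective hX
  haveI := HodgeTheory.connectedSpace_complexPoints hX
  haveI : CompactSpace A.carrier := A.compactSpace_carrier hX
  haveI : Nonempty A.carrier := ⟨A.isAnalytification.homeomorph.symm (Classical.arbitrary _)⟩
  haveI : ConnectedSpace A.carrier :=
    A.isAnalytification.homeomorph.symm.surjective.connectedSpace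
      A.isAnalytification.homeomorph.symm.continuous
  have hfin : Module.finrank ℂ A.model = 2 := A.isAnalytification.finrank_eq
  -- `A.carrier` is compact Kähler
  haveI : AlgebraicGeometry.SmoothOfRelativeDimension 2 S.hom := hX.smoothOfRelativeDimension
  obtain ⟨N, ι, hι⟩ := hX.isProjectiveOver
  haveI : Literature.Geometry.Kaehler.IsKaehlerManifold A.model A.carrier :=
    Motives.isKaehlerManifold_of_isAnalytification_of_isClosedImmersion_holds (X := S) (d := 2)
      (E := A.model) (M := A.carrier) (φ := A.toComplexPoints) ι A.isAnalytification
  haveI : WedgeFacts 𝓘(ℝ, A.model) A.carrier ℝ :=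
    wedgeFacts_of_assoc 𝓘(ℝ, A.model) A.carrier ℝ (ContinuousAlternatingMap.WedgeAssoc_holds ℝ A.model ℝ)
  haveI : WedgeFacts 𝓘(ℝ, A.model) A.carrier ℂ :=
    wedgeFacts_of_assoc 𝓘(ℝ, A.model) A.carrier ℂ (ContinuousAlternatingMap.WedgeAssoc_holds ℝ A.model ℂ)
  haveI : Fact (finrank ℝ A.model = 2 * 2) := ⟨by rw [finrank_real_of_complex, hfin]⟩
  letI : MeasurableSpace A.model := borel _
  haveI : BorelSpace A.model := ⟨rfl⟩
  have h2d : 2 * finrank ℂ A.model = 2 * 2 := by rw [hfin]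
  have h21 : 2 * 1 + 2 * 1 = 2 * 2 := rfl
  have hc22 : 2 + 2 = 2 * 2 := rfl
  -- the comparison map `φ : A.carrier → S(ℂ)` (a homeomorphism)
  set φ : C(A.carrier, Motives.ComplexPoints S) :=
    ⟨A.toComplexPoints, A.isAnalytification.isHomeomorph.continuous⟩ with hφ
  have hsurj : ∀ k, Function.Surjective (singularCohomology.map ℝ ℝ φ k) := fun k ↦
    (singularCohomology.mapIso ℝ ℝ A.isAnalytification.homeomorph k).toLinearEquiv.surjective
  -- the K3 form `η`: smooth, closed, of type `(2,0)`, not exact; `ρ = Re(η ∧ η̄)` vanishes nowhere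
  have hηs : IsSmoothForm η := hη.isSmoothForm
  have hηt : IsOfType 2 0 η := hη.isOfType
  have hcc : η ∈ cclosedSmoothForms A.model A.carrier 2 := hη.mem_cclosedSmoothForms hfin
  have hcc' : η.conj ∈ cclosedSmoothForms A.model A.carrier 2 := conj_mem_cclosedSmoothForms_holds hcc
  have hne0 : η ≠ 0 := fun h ↦ by
    obtain ⟨x⟩ := (inferInstance : Nonempty A.carrier)
    exact hη0 x (by rw [h]; rfl)
  have hnex : η ∉ cexactSmoothForms A.model A.carrier 2 :=
    HodgeTheory.Voisin2002_closedForm_top_zero_not_exact_holds A.model A.carrier 2 hfin η hηs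
      (hη.isClosedForm hfin) hηt hne0
  have hζ : η.wedge η.conj ∈ cclosedSmoothForms A.model A.carrier (2 + 2) :=
    HodgeTheory.wedge_mem_cclosedSmoothForms hcc hcc'
  have hρ : (η.wedge η.conj).re ∈ closedSmoothForms 𝓘(ℝ, A.model) A.carrier ℝ (2 + 2) :=
    re_mem_closedSmoothForms hζ
  have hρne : ∀ x, (η.wedge η.conj).re x ≠ 0 := fun x ↦ re_wedge_conj_apply_ne_zero hfin hηt (hη0 x)
  -- THE COMPLEX ORIENTATION `μ`: positive on `e[Re(η ∧ η̄)]`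
  obtain ⟨μ, hμ⟩ := exists_orientation_kroneckerPairing_pos_of_family (n := 2) hX A e hρ hρne
  set FX := singularHomology.coeffChange (Motives.ComplexPoints S)
    (algebraMap ℤ ℝ : ℤ →+* ℝ).toAddMonoidHom (2 * 2) μ.fundamentalClass with hFX
  -- (b) Kähler positivity for `μ`, by deformation from `Re(η ∧ η̄)`
  have hKpos : ∀ (gK : Bundle.ContMDiffRiemannianMetric 𝓘(ℝ, A.model) ∞ A.model
        (fun x : A.carrier ↦ TangentSpace 𝓘(ℝ, A.model) x))
      (_ : gK.toRiemannianMetric.IsKaehler)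
      (hω : gK.toRiemannianMetric.kaehlerForm.wedge gK.toRiemannianMetric.kaehlerForm ∈
        closedSmoothForms 𝓘(ℝ, A.model) A.carrier ℝ (2 + 2))
      (y : singularCohomology ℝ ℝ (Motives.ComplexPoints S) (2 * 2)),
      singularCohomology.map ℝ ℝ φ (2 * 2) y = e A.carrier (2 * 2) (deRhamCohomology.mk
        ⟨gK.toRiemannianMetric.kaehlerForm.wedge gK.toRiemannianMetric.kaehlerForm, hω⟩) →
      0 < kroneckerPairing ℝ ℝ (Motives.ComplexPoints S) (2 * 2) y FX := by
    intro gK hgK hω y hy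
    obtain ⟨y₁, hy₁⟩ := hsurj (2 * 2) (e A.carrier (2 * 2) (deRhamCohomology.mk ⟨(η.wedge η.conj).re, hρ⟩))
    have hherm := hgK.isHermitian
    refine kroneckerPairing_fundamentalClass_pos_of_convex_of_family (n := 2) hX A e hρ hω
      (fun t ht x ↦ ?_) μ hy₁ hy (hμ y₁ hy₁)
    exact convex_re_wedge_conj_wedge_self_apply_ne_zero hfin hηt
      (fun x v hv ↦ HodgeTheory.kaehlerForm_self_tangentJ_pos gK.toRiemannianMetric hherm x v hv)
      (fun x v w ↦ hherm.kaehlerForm_tangentJ_tangentJ x v w) (hη0 x) ht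
  -- a Kähler metric `gK`, its Kähler form `ωK`, the Kähler class `κ`
  obtain ⟨gK, hgK⟩ := Literature.Geometry.Kaehler.IsKaehlerManifold.exists_isKaehler
    (E := A.model) (M := A.carrier)
  have hH := hgK.isHermitian
  set ωK := gK.toRiemannianMetric.kaehlerForm with hωKdef
  have hωs : IsSmoothForm ωK :=
    Literature.Geometry.Kaehler.isSmoothForm_kaehlerForm_of_isManifold_complex_holds
      (E := A.model) (M := A.carrier) gK
  have hωc : ωK ∈ closedSmoothForms 𝓘(ℝ, A.model) A.carrier ℝ 2 := ⟨hωs, hgK.isClosedForm_kaehlerForm⟩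
  have hωω : ωK.wedge ωK ∈ closedSmoothForms 𝓘(ℝ, A.model) A.carrier ℝ (2 + 2) :=
    wedge_mem_closedSmoothForms hωc hωc
  obtain ⟨κ, hκ⟩ := hsurj (2 * 1) (e A.carrier (2 * 1) (deRhamCohomology.mk ⟨ωK, hωc⟩))
  obtain ⟨yω, hyω⟩ := hsurj (2 * 2) (e A.carrier (2 * 2) (deRhamCohomology.mk ⟨ωK.wedge ωK, hωω⟩))
  have hyωpos : 0 < kroneckerPairing ℝ ℝ (Motives.ComplexPoints S) (2 * 2) yω FX :=
    hKpos gK hgK hωω yω hyω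
  -- (ii) for `μ`: the orientation of `exists_orientation_hodgeRiemann_kaehler` is `μ`
  obtain ⟨μ₁, hHR₁, hK₁⟩ := hS.exists_orientation_hodgeRiemann_kaehler A hη hη0 e he hem
  have hμ₁ : μ₁ = μ := by
    rcases HomologicalOrientation.eq_or_eq_neg_of_connected_holds (Motives.ComplexPoints S) μ₁ μ
      with h | h
    · exact h
    · exfalso
      have h₁ := hK₁ gK hgK hωω yω hyω
      have h₂ := hyωpos
      rw [h, HomologicalOrientation.fundamentalClass_neg_holds (R := ℤ)
        (X := Motives.ComplexPoints S) (2 * 2) μ,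
        map_neg (singularHomology.coeffChange (Motives.ComplexPoints S)
          (algebraMap ℤ ℝ : ℤ →+* ℝ).toAddMonoidHom (2 * 2)),
        map_neg (kroneckerPairing ℝ ℝ (Motives.ComplexPoints S) (2 * 2) yω)] at h₁
      rw [hFX] at h₂
      linarith
  have hHR := hHR₁
  rw [hμ₁] at hHR
  refine ⟨μ, hHR, ?_⟩
  -- metric instances, the complex orientation family `o` with `∫ ω² > 0`, smooth volume form
  letI : RiemannianBundle (fun x : A.carrier ↦ TangentSpace 𝓘(ℝ, A.model) x) := ⟨gK.toRiemannianMetric⟩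
  haveI : IsContMDiffRiemannianBundle 𝓘(ℝ, A.model) ∞ A.model
      (fun x : A.carrier ↦ TangentSpace 𝓘(ℝ, A.model) x) := ⟨gK.inner, gK.contMDiff, fun _ _ _ ↦ rfl⟩
  haveI : IsContinuousRiemannianBundle A.model (fun x : A.carrier ↦ TangentSpace 𝓘(ℝ, A.model) x) :=
    ⟨gK.inner, gK.contMDiff.continuous, fun _ _ _ ↦ rfl⟩
  obtain ⟨o₀, ho, hωpos⟩ :=
    exists_orientation_integral_kaehlerFormPow_castDeg_pos (M := A.carrier) h2d gK hH
  set o : (x : A.carrier) → Orientation ℝ (TangentSpace 𝓘(ℝ, A.model) x) (Fin (2 * 2)) :=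
    fun _ ↦ o₀ with hodef
  have hvol : IsSmoothForm (riemannianVolumeForm o) :=
    isSmoothForm_riemannianVolumeForm_of_isContinuousOrientation_holds o ho
  -- the top form `t₀ = ω ∧ ω` in degree `2 * 2`; `∫ t₀ > 0`
  have ht₀eq := kaehlerFormPow_finrank_castDeg_eq gK.toRiemannianMetric hfin h2d hc22
  set t₀ : MForm 𝓘(ℝ, A.model) A.carrier ℝ (2 * 2) := (ωK.wedge ωK).castDeg hc22 with ht₀def
  have ht₀ : t₀ ∈ closedSmoothForms 𝓘(ℝ, A.model) A.carrier ℝ (2 * 2) :=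
    castDeg_mem_closedSmoothForms _ hωω
  have hI₀ : 0 < t₀.integral o := by rw [← ht₀eq]; exact hωpos
  have hcls : (⟨t₀, ht₀⟩ : closedSmoothForms 𝓘(ℝ, A.model) A.carrier ℝ (2 * 2)) = ⟨ωK.wedge ωK, hωω⟩ := by
    apply Subtype.ext
    funext x
    ext v
    change t₀ x v = (ωK.wedge ωK) x v
    rw [ht₀def, MForm.castDeg_apply]
    exact congrArg ((ωK.wedge ωK) x) (funext fun i ↦ congrArg v (Fin.ext rfl))
  have hyω' : singularCohomology.map ℝ ℝ φ (2 * 2) yω =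
      e A.carrier (2 * 2) (deRhamCohomology.mk ⟨t₀, ht₀⟩) := by rw [hcls]; exact hyω
  -- the Kronecker functional of `μ` on top classes is `K • ∫_M`, `K > 0`
  obtain ⟨K, hK, hTK⟩ := exists_kroneckerPairing_eq_mul_integral hX A e μ o ho ht₀ hI₀ hyω' hyωpos
  -- the `(2,0)`-class `σ₀` (transport of `[η]` through `e ⊗ ℂ`), its real and imaginary parts
  let A' : HodgeTheory.HodgeModel 2 S :=
    { A with
      deRham := e.complexify
      deRham_isNatural := DeRhamIsoFamily.complexify_isNatural he }
  set u := complexDeRhamCohomology.mk A.model A.carrier 2 ⟨η, hcc⟩ with hu_def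
  have hu20 : u ∈ hodgePQ A.model A.carrier 2 2 0 := Submodule.subset_span ⟨⟨η, hcc⟩, hηt, rfl⟩
  have hu0 : u ≠ 0 := by
    intro h0
    rw [hu_def, ← (complexDeRhamCohomology.mk A.model A.carrier 2).map_zero,
      complexDeRhamCohomology.mk_eq_mk_iff] at h0
    exact hnex (by simpa using h0)
  obtain ⟨σ₀, hσ₀⟩ := A'.pullback_surjective (2 * 1) (complexifyFun e 2 u)
  have hσ₀' : singularCohomology.map ℂ ℂ φ (2 * 1) σ₀ = complexifyFun e 2 u := hσ₀
  have hσ₀T : HodgeTheory.IsOfHodgeType 2 S (2 * 1) 2 0 σ₀ := ⟨A', by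
    show A'.pullback 2 σ₀ ∈ A'.hodgePQ 2 2 0
    rw [show A'.pullback 2 σ₀ = complexifyFun e 2 u from hσ₀]
    exact Submodule.mem_map_of_mem hu20⟩
  have hσ₀0 : σ₀ ≠ 0 := by
    intro h0
    apply hu0
    have h1 : complexifyFun e 2 u = 0 := by rw [← hσ₀', h0, map_zero]
    apply (e.complexifyEquiv A.carrier 2).injective
    rw [HodgeTheory.complexifyEquiv_apply, h1, map_zero]
  set ρ₁ := reClass (Motives.ComplexPoints S) (2 * 1) σ₀ with hρ₁def
  set ρ₂ := imClass (Motives.ComplexPoints S) (2 * 1) σ₀ with hρ₂def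
  have hσsplit : σ₀ = ofRealClass (Motives.ComplexPoints S) (2 * 1) ρ₁ +
      Complex.I • ofRealClass (Motives.ComplexPoints S) (2 * 1) ρ₂ :=
    (HodgeTheory.ofRealClass_reClass_add_I_smul σ₀).symm
  have hσconj : conjClass (Motives.ComplexPoints S) (2 * 1) σ₀ =
      ofRealClass (Motives.ComplexPoints S) (2 * 1) ρ₁ -
        Complex.I • ofRealClass (Motives.ComplexPoints S) (2 * 1) ρ₂ :=
    HodgeTheory.conjClass_eq_reClass_sub_imClass σ₀
  -- the real cup pairing `B` of `μ`
  set B : singularCohomology ℝ ℝ (Motives.ComplexPoints S) (2 * 1) →ₗ[ℝ]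
      singularCohomology ℝ ℝ (Motives.ComplexPoints S) (2 * 1) →ₗ[ℝ] ℝ :=
    (cupProduct h21).compr₂ ((kroneckerPairing ℝ ℝ (Motives.ComplexPoints S) (2 * 2)).flip FX)
    with hBdef
  have hB : ∀ x y, B x y =
      kroneckerPairing ℝ ℝ (Motives.ComplexPoints S) (2 * 2) (cupProduct h21 x y) FX :=
    fun x y ↦ by rw [hBdef, LinearMap.compr₂_apply, LinearMap.flip_apply]
  have hBsymm : ∀ x y, B x y = B y x := fun x y ↦ by
    rw [hB, hB, cupProduct_gradedComm_holds ℝ (Motives.ComplexPoints S) h21 h21 y x]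
    norm_num
  -- real classes in top degree are detected by the pairing with `[S(ℂ)] ⊗ 1`
  have hdet : ∀ z : singularCohomology ℝ ℝ (Motives.ComplexPoints S) (2 * 2),
      kroneckerPairing ℝ ℝ (Motives.ComplexPoints S) (2 * 2) z FX = 0 → z = 0 := fun z hz ↦
    eq_zero_of_kroneckerPairing_coeffChange_fundamentalClass_eq_zero ℝ μ hz
  -- expansion of complex cup products `(c ⊗ 1) ∪ (a ⊗ 1 + s • b ⊗ 1)`
  have hexp : ∀ (s : ℂ) (a b c : singularCohomology ℝ ℝ (Motives.ComplexPoints S) (2 * 1)),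
      cupProduct h21 (ofRealClass _ (2 * 1) c)
        (ofRealClass _ (2 * 1) a + s • ofRealClass _ (2 * 1) b) =
      ofRealClass _ (2 * 2) (cupProduct h21 c a) + s • ofRealClass _ (2 * 2) (cupProduct h21 c b) := by
    intro s a b c
    rw [map_add, map_smul, HodgeTheory.ofRealClass_cupProduct, HodgeTheory.ofRealClass_cupProduct]
  -- `a ⊗ 1 + i • b ⊗ 1 = 0 ⇒ a = b = 0`
  have hreim : ∀ (a b : singularCohomology ℝ ℝ (Motives.ComplexPoints S) (2 * 2)),
      ofRealClass _ (2 * 2) a + Complex.I • ofRealClass _ (2 * 2) b = 0 → a = 0 ∧ b = 0 := by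
    intro a b h
    have ha := congrArg (reClass (Motives.ComplexPoints S) (2 * 2)) h
    have hb := congrArg (imClass (Motives.ComplexPoints S) (2 * 2)) h
    rw [map_add, HodgeTheory.reClass_ofRealClass, HodgeTheory.reClass_I_smul,
      HodgeTheory.imClass_ofRealClass, neg_zero, add_zero, map_zero] at ha
    rw [map_add, HodgeTheory.imClass_ofRealClass, HodgeTheory.imClass_I_smul,
      HodgeTheory.reClass_ofRealClass, zero_add, map_zero] at hb
    exact ⟨ha, hb⟩
  -- (P1) `B κ κ > 0`
  have hww : (deRhamCohomology.closedWedge h21 ⟨ωK, hωc⟩ ⟨ωK, hωc⟩ :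
      closedSmoothForms 𝓘(ℝ, A.model) A.carrier ℝ (2 * 2)) = ⟨ωK.wedge ωK, hωω⟩ := by
    apply Subtype.ext
    funext x
    ext v
    rw [deRhamCohomology.coe_closedWedge, MForm.castDeg_apply]
    exact congrArg ((ωK.wedge ωK) x) (funext fun i ↦ congrArg v (Fin.ext rfl))
  have hκκ : 0 < B κ κ := by
    rw [hB]
    refine hKpos gK hgK hωω _ ?_
    rw [cupProduct_map, hκ, ← hem A.carrier (2 * 1) (2 * 1) (2 * 2) h21, deRhamCohomology.cup_mk_mk,
      hww]
  -- `κ ⊗ 1` is of type `(1,1)`; hence `κ ⊥ Re σ₀, Im σ₀` (Huybrechts Ch. 3 Prop. 3.5 / (3))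
  have hI := HodgeTheory.hodgePQ_independent_of_hodgeModel_holds
  have h3 := (Huybrechts_K3_hodgeTypes_H2_holds S hS σ₀ hσ₀T hσ₀0).2.2
  have hκT : HodgeTheory.IsOfHodgeType 2 S (2 * 1) 1 1 (ofRealClass _ (2 * 1) κ) := ⟨A', by
    show A'.pullback (2 * 1) (ofRealClass _ (2 * 1) κ) ∈ A'.hodgePQ (2 * 1) 1 1
    have h1 : A'.pullback (2 * 1) (ofRealClass _ (2 * 1) κ) =
        complexifyFun e (2 * 1) (complexDeRhamCohomology.mk A.model A.carrier (2 * 1)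
          ⟨ωK.ofReal, ofReal_mem_cclosedSmoothForms hωc⟩) := by
      show singularCohomology.map ℂ ℂ φ (2 * 1) (ofRealClass _ (2 * 1) κ) = _
      rw [← HodgeTheory.ofRealClass_map, hκ, ← HodgeTheory.complexifyFun_ofReal,
        complexDeRhamCohomology.ofReal_mk]
    rw [h1]
    exact Submodule.mem_map_of_mem (Submodule.subset_span
      ⟨⟨ωK.ofReal, ofReal_mem_cclosedSmoothForms hωc⟩,
        isOfType_one_one_kaehlerForm_ofReal' gK.toRiemannianMetric hH, rfl⟩)⟩
  have hκρ : B κ ρ₁ = 0 ∧ B κ ρ₂ = 0 := by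
    have h1 := ((h3 _).1 hκT).1
    rw [hσsplit, hexp] at h1
    obtain ⟨ha, hb⟩ := hreim _ _ h1
    rw [hB, hB, ha, hb, LinearMap.map_zero₂]
    exact ⟨rfl, rfl⟩
  -- (P2) `B ρ₁ ρ₁ = B ρ₂ ρ₂ > 0`, `B ρ₁ ρ₂ = 0`: from (ii) and `σ₀ ∪ σ₀ = 0`
  obtain ⟨g, hg1, -⟩ := exists_integral_orientation_generator_top hX μ
  obtain ⟨cσ, hcσ, hσσ⟩ := hHR σ₀ hσ₀T hσ₀0 g hg1
  have hdR : ∀ (E : Type) [NormedAddCommGroup E] [NormedSpace ℂ E] [FiniteDimensional ℂ E],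
      exists_deRhamIsoFamily 𝓘(ℝ, E) := fun E _ _ _ ↦ exists_deRhamIsoFamily_holds E
  have hσsq := hS.cupProduct_twoZero_self hI hdR hσ₀T
  -- two-sided expansion of complex cup products of complexified real classes
  have hexp2 : ∀ (s t : ℂ) (a b c d : singularCohomology ℝ ℝ (Motives.ComplexPoints S) (2 * 1)),
      cupProduct h21 (ofRealClass _ (2 * 1) c + t • ofRealClass _ (2 * 1) d)
        (ofRealClass _ (2 * 1) a + s • ofRealClass _ (2 * 1) b) =
      (ofRealClass _ (2 * 2) (cupProduct h21 c a) + s • ofRealClass _ (2 * 2) (cupProduct h21 c b)) +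
        t • (ofRealClass _ (2 * 2) (cupProduct h21 d a) +
          s • ofRealClass _ (2 * 2) (cupProduct h21 d b)) := by
    intro s t a b c d
    rw [LinearMap.map_add₂, LinearMap.map_smul₂, hexp, hexp]
  have hexp3 : ∀ (s t : ℂ) (a b c d : singularCohomology ℝ ℝ (Motives.ComplexPoints S) (2 * 1)),
      cupProduct h21 (ofRealClass _ (2 * 1) c - t • ofRealClass _ (2 * 1) d)
        (ofRealClass _ (2 * 1) a + s • ofRealClass _ (2 * 1) b) =
      (ofRealClass _ (2 * 2) (cupProduct h21 c a) + s • ofRealClass _ (2 * 2) (cupProduct h21 c b)) -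
        t • (ofRealClass _ (2 * 2) (cupProduct h21 d a) +
          s • ofRealClass _ (2 * 2) (cupProduct h21 d b)) := by
    intro s t a b c d
    rw [LinearMap.map_sub₂, LinearMap.map_smul₂, hexp, hexp]
  -- `σ₀ ∪ σ₀ = (ρ₁² − ρ₂²) ⊗ 1 + i (ρ₁ρ₂ + ρ₂ρ₁) ⊗ 1`
  have E1 : cupProduct h21 (ofRealClass _ (2 * 1) ρ₁ + Complex.I • ofRealClass _ (2 * 1) ρ₂)
      (ofRealClass _ (2 * 1) ρ₁ + Complex.I • ofRealClass _ (2 * 1) ρ₂) =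
      ofRealClass _ (2 * 2) (cupProduct h21 ρ₁ ρ₁ - cupProduct h21 ρ₂ ρ₂) +
        Complex.I • ofRealClass _ (2 * 2) (cupProduct h21 ρ₁ ρ₂ + cupProduct h21 ρ₂ ρ₁) := by
    rw [hexp2]
    simp only [map_sub, map_add, smul_add, smul_smul, Complex.I_mul_I, neg_one_smul]
    abel
  -- `σ̄₀ ∪ σ₀ = (ρ₁² + ρ₂²) ⊗ 1 + i (ρ₁ρ₂ − ρ₂ρ₁) ⊗ 1`
  have E2 : cupProduct h21 (ofRealClass _ (2 * 1) ρ₁ - Complex.I • ofRealClass _ (2 * 1) ρ₂)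
      (ofRealClass _ (2 * 1) ρ₁ + Complex.I • ofRealClass _ (2 * 1) ρ₂) =
      ofRealClass _ (2 * 2) (cupProduct h21 ρ₁ ρ₁ + cupProduct h21 ρ₂ ρ₂) +
        Complex.I • ofRealClass _ (2 * 2) (cupProduct h21 ρ₁ ρ₂ - cupProduct h21 ρ₂ ρ₁) := by
    rw [hexp3]
    simp only [map_sub, map_add, smul_add, smul_sub, smul_smul, Complex.I_mul_I, neg_one_smul]
    abel
  have h0 := hσsq
  rw [hσsplit] at h0
  rw [E1] at h0
  obtain ⟨hre, him⟩ := hreim _ _ h0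
  have hcs := hσσ
  rw [hσconj] at hcs
  rw [hσsplit] at hcs
  rw [E2, ← ofRealClass_ringChange_int] at hcs
  have hre2 := congrArg (reClass (Motives.ComplexPoints S) (2 * 2)) hcs
  simp only [map_add, HodgeTheory.reClass_ofRealClass, HodgeTheory.imClass_ofRealClass,
    HodgeTheory.reClass_smul, Complex.I_re, zero_smul, smul_zero, sub_zero, add_zero] at hre2
  have hsum : B ρ₁ ρ₁ + B ρ₂ ρ₂ = cσ.re := by
    rw [hB, hB, ← LinearMap.add_apply, ← map_add, hre2, LinearMap.map_smul₂, hFX,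
      Literature.Geometry.Manifold.kroneckerPairing_ringChange_coeffChange ℝ g μ.fundamentalClass,
      hg1, map_one, smul_eq_mul, mul_one]
  have hdiff : B ρ₁ ρ₁ = B ρ₂ ρ₂ := by
    rw [hB, hB, ← sub_eq_zero, ← LinearMap.sub_apply, ← map_sub, hre, LinearMap.map_zero₂]
  have hcomm : cupProduct h21 ρ₂ ρ₁ = cupProduct h21 ρ₁ ρ₂ := by
    rw [cupProduct_gradedComm_holds ℝ (Motives.ComplexPoints S) h21 h21 ρ₂ ρ₁]
    norm_num
  have h12 : B ρ₁ ρ₂ = 0 := by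
    rw [hcomm, ← two_smul ℝ] at him
    rw [hB, (smul_eq_zero.1 him).resolve_left two_ne_zero, LinearMap.map_zero₂]
  have hρ₁pos : 0 < B ρ₁ ρ₁ := by linarith
  have hρ₂pos : 0 < B ρ₂ ρ₂ := hdiff ▸ hρ₁pos
  -- the frame `v = (ρ₁, ρ₂, κ)`: pairwise orthogonal with positive squares
  set v : Fin 3 → singularCohomology ℝ ℝ (Motives.ComplexPoints S) (2 * 1) := ![ρ₁, ρ₂, κ] with hvdef
  have hvdiag : ∀ i, 0 < B (v i) (v i) := by
    intro i
    fin_cases i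
    · exact hρ₁pos
    · exact hρ₂pos
    · exact hκκ
  have hvoff : ∀ i j, i ≠ j → B (v i) (v j) = 0 := by
    intro i j hij
    fin_cases i <;> fin_cases j
    · exact absurd rfl hij
    · exact h12
    · exact (hBsymm _ _).trans hκρ.1
    · exact (hBsymm _ _).trans h12
    · exact absurd rfl hij
    · exact (hBsymm _ _).trans hκρ.2
    · exact hκρ.1
    · exact hκρ.2
    · exact absurd rfl hij
  have hBsum : ∀ c : Fin 3 → ℝ,
      B (∑ i, c i • v i) (∑ j, c j • v j) = ∑ i, c i * c i * B (v i) (v i) := by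
    intro c
    rw [bilin_sum_smul_sum_smul]
    refine Finset.sum_congr rfl fun i _ ↦ ?_
    rw [Finset.sum_eq_single i]
    · intro j _ hji
      rw [hvoff i j (Ne.symm hji), mul_zero]
    · intro hi
      exact absurd (Finset.mem_univ i) hi
  have hBsum_pos : ∀ c : Fin 3 → ℝ, ∀ i, c i ≠ 0 → 0 < B (∑ i, c i • v i) (∑ j, c j • v j) := by
    intro c i hi
    rw [hBsum]
    refine lt_of_lt_of_le (mul_pos (mul_self_pos.2 hi) (hvdiag i)) ?_
    exact Finset.single_le_sum (f := fun i ↦ c i * c i * B (v i) (v i))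
      (fun i _ ↦ mul_nonneg (mul_self_nonneg _) (hvdiag i).le) (Finset.mem_univ i)
  -- `V = span v` is positive definite of dimension `3`
  set V := Submodule.span ℝ (Set.range v) with hVdef
  have hVpos : ∀ x ∈ V, x ≠ 0 → 0 < kroneckerPairing ℝ ℝ (Motives.ComplexPoints S) (2 * 2)
      (cupProduct h21 x x) FX := by
    intro x hx hx0
    obtain ⟨c, rfl⟩ := (Submodule.mem_span_range_iff_exists_fun ℝ).1 hx
    obtain ⟨i₀, hi₀⟩ : ∃ i, c i ≠ 0 := by
      by_contra hall
      push Not at hall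
      apply hx0
      exact Finset.sum_eq_zero fun i _ ↦ by rw [hall i, zero_smul]
    rw [← hB]
    exact hBsum_pos c i₀ hi₀
  have hvli : LinearIndependent ℝ v := by
    rw [Fintype.linearIndependent_iff]
    intro c hc i
    by_contra hi
    have hpos := hBsum_pos c i hi
    rw [hc, LinearMap.map_zero₂] at hpos
    exact lt_irrefl _ hpos
  have hVrank : Module.finrank ℝ V = 3 := by
    rw [hVdef, finrank_span_eq_card hvli, Fintype.card_fin]
  -- `W = {y : B y ρ₁ = B y ρ₂ = B y κ = 0}` is negative definite of dimension `≥ 22 − 3`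
  set L : singularCohomology ℝ ℝ (Motives.ComplexPoints S) (2 * 1) →ₗ[ℝ] (Fin 3 → ℝ) :=
    LinearMap.pi (fun i ↦ B.flip (v i)) with hLdef
  have hLapply : ∀ y i, L y i = B y (v i) := fun y i ↦ by
    rw [hLdef, LinearMap.pi_apply, LinearMap.flip_apply]
  set W := LinearMap.ker L with hWdef
  have hWmem : ∀ y ∈ W, ∀ i, B y (v i) = 0 := by
    intro y hy i
    rw [← hLapply, LinearMap.mem_ker.1 hy, Pi.zero_apply]
  have hWneg : ∀ y ∈ W, y ≠ 0 → kroneckerPairing ℝ ℝ (Motives.ComplexPoints S) (2 * 2)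
      (cupProduct h21 y y) FX < 0 := by
    intro y hy hy0
    have hy₁ : cupProduct h21 y ρ₁ = 0 := hdet _ (by rw [← hB]; exact hWmem y hy 0)
    have hy₂ : cupProduct h21 y ρ₂ = 0 := hdet _ (by rw [← hB]; exact hWmem y hy 1)
    have hyκ : cupProduct h21 y κ = 0 := hdet _ (by rw [← hB]; exact hWmem y hy 2)
    -- `y ⊗ 1` is of type `(1,1)`: it is orthogonal to `σ₀` and `σ̄₀`
    have hyσ : cupProduct h21 (ofRealClass _ (2 * 1) y) σ₀ = 0 := by
      rw [hσsplit, hexp, hy₁, hy₂, map_zero, smul_zero, add_zero]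
    have hyσ' : cupProduct h21 (ofRealClass _ (2 * 1) y) (conjClass _ (2 * 1) σ₀) = 0 := by
      rw [hσconj, sub_eq_add_neg, ← neg_smul, hexp, hy₁, hy₂, map_zero, smul_zero, add_zero]
    have hy11 : HodgeTheory.IsOfHodgeType 2 S (2 * 1) 1 1 (ofRealClass _ (2 * 1) y) :=
      (h3 _).2 ⟨hyσ, hyσ'⟩
    have hκy : cupProduct h21 κ y = 0 := by
      rw [cupProduct_gradedComm_holds ℝ (Motives.ComplexPoints S) h21 h21 κ y, hyκ, smul_zero]
    exact kroneckerPairing_cupProduct_self_neg_of_isOfHodgeType_oneOne hX A e he hem μ gK hgK o hvol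
      (hodge_riemann_bilinear_holds o gK) h2d hωpos hK hTK hωc hκ hy0 hy11 hκy
  -- dimension count
  haveI : Module.Finite ℝ (singularCohomology ℝ ℝ (Motives.ComplexPoints S) (2 * 1)) :=
    finite_singularCohomology_of_compact_chartedSpace ℝ ℝ (d := 2 * 2) (2 * 1)
  have hHrank : Module.finrank ℂ (HodgeTheory.complexBetti S (2 * 1)) =
      Module.finrank ℝ (singularCohomology ℝ ℝ (Motives.ComplexPoints S) (2 * 1)) := by
    show Module.finrank ℂ (singularCohomology ℂ ℂ (Motives.ComplexPoints S) (2 * 1)) = _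
    rw [finrank_singularCohomology_eq_bettiNumber_of_field,
      finrank_singularCohomology_eq_bettiNumber_of_field, bettiNumber_real_eq_complex]
  have hWrank : Module.finrank ℝ (singularCohomology ℝ ℝ (Motives.ComplexPoints S) (2 * 1)) ≤
      Module.finrank ℝ W + 3 := by
    have h1 := LinearMap.finrank_range_add_finrank_ker L
    have h2 : Module.finrank ℝ (LinearMap.range L) ≤ 3 := by
      have := Submodule.finrank_le (LinearMap.range L)
      rwa [Module.finrank_fin_fun] at this
    rw [hWdef]
    omega
  have hA₁ := sigPos_intersectionForm_add_finrank_le μ h21 W hWneg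
  have hA₂ := sigNeg_intersectionForm_add_finrank_le μ h21 V hVpos
  rw [hVrank] at hA₂
  have hsum' := finrank_eq_sigPos_add_sigNeg_intersectionForm_holds (X := Motives.ComplexPoints S)
    (k := 2 * 1) (n := 2 * 2) (even_two_mul 1) h21 μ
  rw [← finrank_singularCohomology_real_eq_finrank_freeCohomology (n := 2 * 2) (2 * 1)] at hsum'
  have hP : sigPos (intersectionForm h21 μ).toQuadraticMap = 3 := by omega
  have hN : sigNeg (intersectionForm h21 μ).toQuadraticMap + 3 =
      Module.finrank ℝ (singularCohomology ℝ ℝ (Motives.ComplexPoints S) (2 * 1)) := by omega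
  rw [hHrank, LinearMap.BilinForm.signature, hP, ← hN]
  push_cast
  ring

/-- **The engine of clause (i).** For a K3 surface `S` with `b₂(S) = 22`, a Hodge model `A`
carrying the nowhere-vanishing holomorphic `2`-form `η`, and a natural multiplicative real de Rham
isomorphism family `e`, there is a `ℤ`-orientation `μ` of `S(ℂ)` (the complex one) with the
Hodge–Riemann positivity (ii) on `H^{2,0}` AND `τ(S(ℂ), μ) = b⁺ − b⁻ = −16`. Printed proof: Huybrechts,
*Lectures on K3 Surfaces*, Ch. 1, proof of Prop. 3.5 (p. 24: "of index `−16` … signature `(3, 19)`"),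
with the index computed by the Hodge index theorem (Voisin I Thm. 6.32/6.33: positive definite on
`(H^{2,0} ⊕ H^{0,2})_ℝ ⊕ ℝκ`, negative definite on the primitive real `(1,1)`-classes) instead of
Thom–Hirzebruch. On the tree's carriers: over `ℝ`, `Re σ`, `Im σ` and the Kähler class `κ` span a
positive definite `3`-space `V` (`(σ.σ̄) > 0` — clause (ii) —, `σ² = 0` —
`IsK3Surface.cupProduct_twoZero_self` —, `κ² > 0`, `κ ⊥ σ` by type — `Huybrechts_K3_hodgeTypes_H2_holds`
(3)); its orthogonal `W` (dimension `≥ 22 − 3`) consists of real primitive classes whose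
complexification is of type `(1,1)` (ibid.), on which the form is negative definite
(`kroneckerPairing_cupProduct_self_neg_of_isOfHodgeType_oneOne`); Thom's inequalities across
`ℤ → ℝ` (`sigPos_intersectionForm_add_finrank_le`, `sigNeg_intersectionForm_add_finrank_le`) and
`b₂ = b⁺ + b⁻ = 22` (`finrank_eq_sigPos_add_sigNeg_intersectionForm_holds`) give `(b⁺, b⁻) = (3, 19)`.
[cite: Huybrechts2016K3, Ch. 1 Prop. 3.5, proof (p. 24); Ch. 6 Prop. 1.2] [cite: VoisinHodgeI2002, §6.3.2 Thm. 6.32 and Thm. 6.33] -/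
theorem IsK3Surface.exists_orientation_hodgeRiemann_signature (hS : IsK3Surface S)
    (h22 : Module.finrank ℂ (HodgeTheory.complexBetti S (2 * 1)) = 22)
    (A : HodgeTheory.HodgeModel 2 S) {η : MForm 𝓘(ℝ, A.model) A.carrier ℂ 2}
    (hη : Literature.Geometry.Kaehler.IsHolomorphicInCharts η) (hη0 : ∀ x, η x ≠ 0)
    (e : DeRhamIsoFamily 𝓘(ℝ, A.model)) (he : e.IsNatural) (hem : e.IsMultiplicative) :
    ∃ μ : HomologicalOrientation ℤ (Motives.ComplexPoints S) (2 * 2),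
      (∀ σ : HodgeTheory.complexBetti S (2 * 1), HodgeTheory.IsOfHodgeType 2 S (2 * 1) 2 0 σ →
        σ ≠ 0 → ∀ g : singularCohomology ℤ ℤ (Motives.ComplexPoints S) (2 * 2),
          kroneckerPairing ℤ ℤ (Motives.ComplexPoints S) (2 * 2) g μ.fundamentalClass = 1 →
            ∃ c : ℂ, 0 < c.re ∧
              cupProduct (rfl : 2 * 1 + 2 * 1 = 2 * 2)
                (HodgeTheory.conjClass (Motives.ComplexPoints S) (2 * 1) σ) σ =
                  c • singularCohomology.ringChange (algebraMap ℤ ℂ) (Motives.ComplexPoints S)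
                    (2 * 2) g) ∧
      (intersectionForm (rfl : 2 * 1 + 2 * 1 = 2 * 2) μ).signature = -16 := by
  obtain ⟨μ, hHR, hsig⟩ := hS.exists_orientation_hodgeRiemann_signature_eq A hη hη0 e he hem
  refine ⟨μ, hHR, ?_⟩
  rw [hsig, h22]
  norm_num

/-- **Clause (i) from `b₂ = 22`: for every K3 surface and every `ℤ`-orientation `μ` of `S(ℂ)` with
the Hodge–Riemann positivity (ii), `τ(S(ℂ), μ) = −16`** — the hypothesis `h` of
`K3_exists_orientation_signature_hodgeRiemann_ample_of_signature`, granted the sibling named fact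
`K3_finrank_complexBetti_two` (`b₂ = 22`, Noether's formula). The (ii)-orientation is unique
(`IsK3Surface.orientation_unique_of_hodgeRiemann_twoZero`), and for the complex orientation of
`IsK3Surface.exists_orientation_hodgeRiemann_signature` (on the Hodge model of the K3 form, read
through the integration isomorphism of de Rham's theorem, natural and multiplicative) the index is
`−16`. [cite: Huybrechts2016K3, Ch. 1 Prop. 3.5, proof (p. 24)] [cite: VoisinHodgeI2002, §6.3.2 Thm. 6.32 and Thm. 6.33] -/
theorem K3_signature_eq_of_hodgeRiemann_twoZero (h22 : K3_finrank_complexBetti_two)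
    (S : Motives.SchemeOver ℂ) (hS : IsK3Surface S)
    (μ : HomologicalOrientation ℤ (Motives.ComplexPoints S) (2 * 2))
    (hμ : ∀ σ : HodgeTheory.complexBetti S (2 * 1), HodgeTheory.IsOfHodgeType 2 S (2 * 1) 2 0 σ →
        σ ≠ 0 → ∀ g : singularCohomology ℤ ℤ (Motives.ComplexPoints S) (2 * 2),
          kroneckerPairing ℤ ℤ (Motives.ComplexPoints S) (2 * 2) g μ.fundamentalClass = 1 →
            ∃ c : ℂ, 0 < c.re ∧
              cupProduct (rfl : 2 * 1 + 2 * 1 = 2 * 2)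
                (HodgeTheory.conjClass (Motives.ComplexPoints S) (2 * 1) σ) σ =
                  c • singularCohomology.ringChange (algebraMap ℤ ℂ) (Motives.ComplexPoints S)
                    (2 * 2) g) :
    (intersectionForm (rfl : 2 * 1 + 2 * 1 = 2 * 2) μ).signature = -16 := by
  obtain ⟨A, η, hη, hη0⟩ := hS.exists_holomorphicTwoForm_ne_zero
  obtain ⟨μ', hμ', hsig⟩ := hS.exists_orientation_hodgeRiemann_signature (h22 S hS) A hη hη0
    (integrationDeRhamIsoFamily A.model) integrationDeRhamIsoFamily_isNatural
    integrationDeRhamIsoFamily_isMultiplicative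
  rw [hS.orientation_unique_of_hodgeRiemann_twoZero hμ hμ']
  exact hsig

/-- **`K3_exists_orientation_signature_hodgeRiemann_ample` from `b₂ = 22`.** The named fact —
signature `(3, 19)`, Hodge–Riemann positivity on `H^{2,0}` and an integral ample `(1,1)`-class, all
for ONE `ℤ`-orientation of `S(ℂ)` — follows from the sibling named fact `K3_finrank_complexBetti_two`
alone: clauses (ii) and (iii) hold for the complex orientation
(`IsK3Surface.exists_orientation_hodgeRiemann_ample`), and clause (i) is the Hodge index theorem with
sign for that orientation (`K3_signature_eq_of_hodgeRiemann_twoZero`), whose only numerical input is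
`b₂ = 22` (`τ = 2 + 2h^{2,0} − h^{1,1} = −16 ⟺ h^{1,1} = 20 ⟺ b₂ = 22`, given `h^{2,0} = 1`).
[cite: Huybrechts2016K3, Ch. 1 Prop. 3.5, proof (p. 24); Ch. 6 Prop. 1.2 (ii); Ch. 1 §2.2 and Prop. 3.2]
[cite: VoisinHodgeI2002, §6.3.2 Thm. 6.32] [cite: MilnorStasheff1974, §19 Thm. 19.4] -/
theorem K3_exists_orientation_signature_hodgeRiemann_ample_of_finrank_complexBetti_two
    (h22 : K3_finrank_complexBetti_two) : K3_exists_orientation_signature_hodgeRiemann_ample :=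
  K3_exists_orientation_signature_hodgeRiemann_ample_of_signature
    (K3_signature_eq_of_hodgeRiemann_twoZero h22)

end K3Signature

end Literature.AlgebraicGeometry.Surfaces

end
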